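import Literature.NumberTheory.LFunctions.TuringMethodTrudgianII
import Literature.NumberTheory.LFunctions.VinogradovKorobovInputsProofs
import Literature.NumberTheory.LFunctions.ZetaOneLineRiemannSiegel
import Literature.NumberTheory.LFunctions.ZetaOneLineBounds
import Literature.NumberTheory.LFunctions.LehmanCriticalLineBoundProofs
import Literature.NumberTheory.LFunctions.ZetaArgBacklundExplicit
import Literature.NumberTheory.LFunctions.ZetaBacklundReflection
import Literature.NumberTheory.LFunctions.ZetaArgPrimeZetaLog
import Literature.Analysis.Complex.BacklundTrick
import HarnessLib

/-!
# `|S(T)| ≤ 0.1035 log T + 0.2395 log log T + 4.92` and Corollary 1.2 of Hasanalizade–Shen–Wong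

Topic `Literature/NumberTheory/LFunctions`.  Everything in this file is PROVED; there are no named
facts and no definitions (the majorant's coefficient functions are variables `αf βf γf` with
defining hypotheses).  The file discharges the named fact
`Literature.NumberTheory.LFunctions.zetaZeroCount_hasanalizade_shen_wong`
([HSW22, Cor. 1.2]: `|N(T) − (T/2π)log(T/2πe)| ≤ 0.1038 log T + 0.2573 log log T + 9.3675` for
`T ≥ e`) as `Literature.NumberTheory.LFunctions.zetaZeroCount_hasanalizade_shen_wong_holds`.

## The argument

The printed proof of Corollary 1.2 combines Theorem 1.3 of [HSW22] at `T₀ = 30 610 046 000`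
(`|S(T)| ≤ 0.103787 log T + 0.257297 log log T + 8.367419`, proved there with Hiary's
`|ζ(½+it)| ≤ 0.77 t^{1/6} log t` and Patel's `|ζ(1+it)| ≤ log t`) with Platt's database of the
`10¹¹` zeros below `T₀`.  The tree already reduces the corollary to any bound of that strength
above `T₀` (`Literature.NumberTheory.LFunctions.zetaZeroCount_hasanalizade_shen_wong_of_large`,
`ZetaArgBacklundExplicit.lean`, using the explicit Backlund bound `0.3083 log T + 3.24` and
`N(30) ≤ 7` below).  Here that bound is proved by the method of [HSW22] (§§2–5: Backlund's trick,
Jensen's formula on circles centred at `c + iT`, Phragmén–Lindelöf majorants), with three changes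
forced or allowed by what the tree proves:

1. **Inputs.** On the critical line, Patel's sub-Weyl bound `|ζ(½+it)| ≤ 307.098|t|^{27/164}`
   (`Literature.NumberTheory.LFunctions.zeta_half_line_patel_holds`, the tree's formalisation of
   Patel–Yang) replaces Hiary's bound: `k₂ = 27/164 < 1/6` and `k₃ = 0` *lower* the slopes
   `C₁, C₂`, the constant `307.098` costs `≈ 0.7` in `C₃`.  On `σ = 1`,
   `|ζ(1+it)| ≤ ½ log t + 1.85` (`…SiegelIntegral.norm_riemannZeta_one_add_le_half_log`) is used as
   `0.6 log|2²⁷ + 1 + it|` (the huge shift `Q₀ = 2²⁷` is harmless against `T₀ ≈ 3·10¹⁰`).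
2. **Parameters.** `c = 1.01`, `r = 2(c − ½) = 1.02` (so `log(r/(c−½)) = log 2`, `σ₁ = 1.265`,
   `δ = 0.255`): the slope is `C₁ = ((1/π)∫₀^π α − 1)/(2 log 2) ≈ 0.10348 ≤ 0.103787` and the
   centre term `log(ζ(c)/ζ(2c))/(2 log 2) ≤ log 101/(2 log 2) ≈ 3.33` (against `7.29` for the
   `c = 1.000011` of [HSW22, Table 2, row 1]).
3. **The reflection error** of Backlund's trick is `1/T` (Stirling for `Im ψ`,
   `ZetaBacklundReflection.lean`) instead of `E(T,δ)/2 + π/4`.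

Chain of the proof of `ZetaArgHSW.abs_zetaArgS_le_of_not_ordinate_hsw` (`T ≥ T₀` not an
ordinate): `π|S(T)| ≤ log ζ(σ₁) + |Im ∫_{1/2}^{σ₁} ζ'/ζ|`
(`ZetaArgPrimeZetaLog.pi_mul_abs_zetaArgS_le`); `ζ'/ζ = ζ₁'/ζ₁ − 1/(s−1)`, `ζ₁ = (s−1)ζ`,
`|Im ∫ ds/(s−1)| ≤ 0.765/T`; Backlund's trick
(`Literature.Analysis.Complex.abs_im_integral_logDeriv_le_backlundTrick`) for `ζ₁` on
`|s − (1.01 + iT)| ≤ 1.02` gives `|Im ∫ ζ₁'/ζ₁| ≤ π(A − log|ζ₁(1.01+iT)|)/(2 log 2) + 1/(2T)`, where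
`log|ζ₁(1.01+iT)| ≥ log T − log 101` and `A` is the circle average of the logarithm
`F(σ) = α(σ)L + β(σ) log L + γ(σ)` (`L = log(T + 2²⁷ + 6)`) of the majorant of `|ζ₁|`
(`ZetaArgHSW.norm_riemannZeta₁_le_exp_abg`): the six ranges of [HSW22, §4.1] —
`σ ≥ 6/5` trivial (`|ζ₁| ≤ N ζ(σ)`, four steps `log 3, log 4, log 5, log 6`), `[1, 6/5]` and
`[½, 1]` by the Trudgian-II Phragmén–Lindelöf lemmas of the tree (`TuringMethodTrudgianII.lean`),
`[0, ½)` and `[−0.01, 0)` by the functional equation — all affine in `σ = 1.01 + 1.02 cos θ`, so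
that `∫₀^π F ≤ 3.5923 L + 1.043 log L + 4.712` (`ZetaArgHSW.integral_majorant_le`, arcs at
`θ = 1.05, 1.24, 1.33, 1.384, θ₁ = arccos(−1/102), 2π/3, θ₀ = arccos(−101/102)` with enclosures of
`θ₁, θ₀`).  Finally `(3.5923/π − 1)/(2 log 2) ≤ 0.1035`, `(1.043/π)/(2 log 2) ≤ 0.2395` and the
constant is `≤ 4.92` (`ZetaArgHSW.final_numeric_hsw`).  Ordinates are reached by right limits
(`abs_zetaArgS_le_hsw`), and `abs_zetaArgS_le_hsw_table2` is the hypothesis of `…_of_large`.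

## Main results

* `ZetaArgHSW.H1_patel`, `ZetaArgHSW.H2_large_Q`, `ZetaArgHSW.norm_riemannZeta₁_le_exp_R3/R2/R1/R4a/R4b`,
  `ZetaArgHSW.norm_riemannZeta₁_le_fe` — [HSW22, §4.1] with the tree's inputs;
* `ZetaArgHSW.norm_riemannZeta₁_le_exp_abg`, `ZetaArgHSW.integral_majorant_le`;
* `ZetaArgHSW.abs_zetaArgS_le_of_not_ordinate_hsw`, `abs_zetaArgS_le_hsw` —
  **`|S(T)| ≤ 0.1035 log T + 0.2395 log log T + 4.92` for `T ≥ 30 610 046 000`**;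
* `abs_zetaArgS_le_hsw_table2` — hence [HSW22, Thm 1.3, Table 2 row 1] for `T ≥ T₀`;
* `zetaZeroCount_hasanalizade_shen_wong_holds` — **[HSW22, Corollary 1.2]**.

## References

* E. Hasanalizade, Q. Shen, P.-J. Wong, *Counting zeros of the Riemann zeta function*, J. Number
  Theory 235 (2022), 219–241, Thm 1.1, Cor. 1.2, Thm 1.3, §§2–5, Table 2.
  [cite: HasanalizadeShenWong2022, Corollary 1.2]
* M. A. Bennett, G. Martin, K. O'Bryant, A. Rechnitzer, *Counting zeros of Dirichlet
  `L`-functions*, Math. Comp. 90 (2021), Prop. 5.4.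
* D. Patel, A. Yang, *An explicit sub-Weyl bound for `ζ(1/2 + it)`*, J. Number Theory 262 (2024),
  (1.2). [cite: PatelYang2024, (1.2)]
* D. Patel, *An explicit upper bound for `|ζ(1+it)|`*, Indag. Math. 33 (2022), Thm 1.1.
  [cite: Patel2022, Thm 1.1]
* T. S. Trudgian, *An improved upper bound for the argument of the Riemann zeta-function on the
  critical line II*, J. Number Theory 134 (2014), Lemma 3.
* E. C. Titchmarsh, *The Theory of the Riemann Zeta-Function*, 2nd ed. (1986), §9.4.
  [cite: Titchmarsh1986, §9.4]
-/


noncomputable section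

open Complex Set Real
open scoped Real ComplexConjugate

namespace Literature.NumberTheory.LFunctions

namespace ZetaArgHSW

/-! ### Numerical constants -/

/-- `log 307.098 ≤ 5.7275`. [folklore] -/
lemma log_k₁_le : Real.log 307.098 ≤ 5.7275 := by
  rw [Real.log_le_iff_le_exp (by norm_num)]
  have h1 : Real.exp 5.7275 = Real.exp 1 ^ 5 * Real.exp 0.7275 := by
    rw [← Real.exp_nat_mul, ← Real.exp_add]; norm_num
  have h2 : (2.0698 : ℝ) ≤ Real.exp 0.7275 := by
    refine le_trans ?_ (Real.sum_le_exp_of_nonneg (by norm_num) 7)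
    norm_num [Finset.sum_range_succ, Nat.factorial]
  have h3 := Real.exp_one_gt_d9
  have h4 : (2.7182818283 : ℝ) ^ 5 ≤ Real.exp 1 ^ 5 := by gcongr
  rw [h1]
  nlinarith [Real.exp_pos 0.7275]

/-- `log (3/5) ≤ −0.5107`. [folklore] -/
lemma log_k₄_le : Real.log (3 / 5) ≤ -0.5107 := by
  rw [Real.log_le_iff_le_exp (by norm_num)]
  have h1 : Real.exp 0.5107 ≤ 1.6666 := by
    refine (Real.exp_bound' (by norm_num) (by norm_num) (n := 5) (by norm_num)).trans ?_
    norm_num [Finset.sum_range_succ, Nat.factorial]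
  have h2 : Real.exp (-0.5107) * Real.exp 0.5107 = 1 := by rw [← Real.exp_add]; norm_num
  nlinarith [Real.exp_pos (-0.5107), Real.exp_pos 0.5107]

/-- `log 6 ≤ 1.7918`. [folklore] -/
lemma log_six_le : Real.log 6 ≤ 1.7918 := by
  rw [Real.log_le_iff_le_exp (by norm_num)]
  have h1 : Real.exp 1.7918 = Real.exp 1 * Real.exp 0.7918 := by
    rw [← Real.exp_add]; norm_num
  have h2 : (2.20732 : ℝ) ≤ Real.exp 0.7918 := by
    refine le_trans ?_ (Real.sum_le_exp_of_nonneg (by norm_num) 8)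
    norm_num [Finset.sum_range_succ, Nat.factorial]
  have h3 := Real.exp_one_gt_d9
  rw [h1]
  nlinarith [Real.exp_pos 0.7918]

/-- `18.71 ≤ log (2^27)`. [folklore] -/
lemma log_two_pow_27_ge : (18.71 : ℝ) ≤ Real.log (2 ^ 27) := by
  rw [Real.log_pow]
  have := Real.log_two_gt_d9
  push_cast
  nlinarith

/-! ### The critical line: `H1` from Patel's bound -/

/-- Patel's bound in the all-`t` shape `|ζ(½+it)| ≤ 307.098 |3+it|^{27/164}`: for `|t| ≥ 3` this
is `Literature.NumberTheory.LFunctions.zeta_half_line_patel_holds`, for `|t| < 3` Lehman's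
`2.53|3+it|^{1/4}` (`|3+it|^{7/82} ≤ 6`). [cite: PatelYang2024, (1.2)] -/
theorem norm_riemannZeta_half_le_patel_allT (t : ℝ) :
    ‖riemannZeta (1 / 2 + t * I)‖ ≤
      307.098 * ‖((3 : ℝ) : ℂ) + t * I‖ ^ (27 / 164 : ℝ) * Real.log ‖((3 : ℝ) : ℂ) + t * I‖ ^ (0 : ℝ) := by
  rw [Real.rpow_zero, mul_one]
  have e3 : (((3 : ℝ) : ℂ)) + t * I = (3 : ℂ) + t * I := by push_cast; rfl
  rw [e3]
  set N : ℝ := ‖(3 : ℂ) + t * I‖ with hN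
  have hNt : |t| ≤ N := by
    rw [hN]; have := abs_im_le_norm ((3 : ℂ) + t * I); simpa using this
  have hN3 : 3 ≤ N := by
    rw [hN]; have := re_le_norm ((3 : ℂ) + t * I); simpa using this
  have hN0 : 0 < N := by linarith
  rcases le_or_gt 3 |t| with ht | ht
  · have h := zeta_half_line_patel_holds t ht
    refine h.trans ?_
    gcongr
  · -- Lehman's bound
    have h := norm_riemannZeta_half_line_le_allT Trudgian2011_lemma_2_5_allT_holds t
    have e : ((5 / 2 : ℝ) : ℂ) + (1 / 2 + t * I) = (3 : ℂ) + t * I := by push_cast; ring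
    rw [e] at h
    refine h.trans ?_
    -- `N ≤ 6` for `|t| < 3`, so `N^{1/4} = N^{27/164} N^{7/82} ≤ 6 N^{27/164}`
    have hN6 : N ≤ 6 := by
      rw [hN]
      refine (norm_le_abs_re_add_abs_im _).trans ?_
      have h1 : ((3 : ℂ) + t * I).re = 3 := by simp
      have h2 : ((3 : ℂ) + t * I).im = t := by simp
      rw [h1, h2, abs_of_pos (by norm_num : (0:ℝ) < 3)]
      linarith [ht.le]
    have hsplit : N ^ (1 / 4 : ℝ) = N ^ (27 / 164 : ℝ) * N ^ (7 / 82 : ℝ) := by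
      rw [← Real.rpow_add hN0]; norm_num
    have h782 : N ^ (7 / 82 : ℝ) ≤ 6 := by
      calc N ^ (7 / 82 : ℝ) ≤ N ^ (1 : ℝ) :=
            Real.rpow_le_rpow_of_exponent_le (by linarith) (by norm_num)
        _ ≤ 6 := by rw [Real.rpow_one]; exact hN6
    rw [hsplit]
    have h0 : 0 ≤ N ^ (27 / 164 : ℝ) := Real.rpow_nonneg hN0.le _
    nlinarith [mul_le_mul_of_nonneg_left h782 h0]

/-- **`H1`**: for every real `u` and every `Q₀ ≥ 5/2`,
`|ζ₁(½+iu)| ≤ 307.098 |Q₀+½+iu|^{27/164+1}` (the edge hypothesis of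
`Literature.NumberTheory.LFunctions.norm_riemannZeta₁_le_trudgianII_half_one` with
`(k₁,k₂,k₃) = (307.098, 27/164, 0)`). [cite: HasanalizadeShenWong2022, (4.4)] -/
theorem H1_patel {Q₀ : ℝ} (hQ₀ : 5 / 2 ≤ Q₀) (u : ℝ) :
    ‖riemannZeta₁ (1 / 2 + u * I)‖ ≤
      307.098 * ‖(Q₀ : ℂ) + (1 / 2 + u * I)‖ ^ ((27 / 164 : ℝ) + 1) *
        Real.log ‖(Q₀ : ℂ) + (1 / 2 + u * I)‖ ^ (0 : ℝ) :=
  norm_riemannZeta₁_half_line_le_of_shifted (by norm_num) (by norm_num) le_rfl (by norm_num)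
    (by linarith) norm_riemannZeta_half_le_patel_allT u

/-! ### The line `σ = 1`: `H2` with `k₄ = 3/5`, `Q₀ = 2²⁷` -/

/-- For `t ≥ 2²⁷ + 1`: `|ζ(1+it)| ≤ (3/5) log t` (`½ log t + 1.85 ≤ 0.6 log t` iff `log t ≥ 18.5`).
[cite: Patel2022, Thm 1.1] -/
theorem norm_riemannZeta_one_le_large {t : ℝ} (ht : (2 : ℝ) ^ 27 + 1 ≤ t) :
    ‖riemannZeta (1 + t * I)‖ ≤ 3 / 5 * Real.log t ^ (1 : ℝ) := by
  rw [Real.rpow_one]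
  have hπ : π < 3.15 := by linarith [Real.pi_lt_d2]
  have ht0 : 128 * π ≤ t := by nlinarith
  have h := SiegelIntegral.norm_riemannZeta_one_add_le_half_log ht0
  have hlog : 18.71 ≤ Real.log t :=
    log_two_pow_27_ge.trans (Real.log_le_log (by norm_num) (by linarith))
  linarith

/-- For `|u| < 2²⁷ + 1`: `|ζ₁(1+iu)| ≤ (3/5)(2²⁷+1) log(2²⁷+1)`. Three ranges: `|u| < 3` (crude
growth of `ζ₁`), `3 ≤ |u| < 2²⁷+1` with `u ≥ 128π` (`½ log u + 1.85`, increasing in `u`) and the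
rest (`21 log|u|`). [folklore] -/
theorem norm_riemannZeta₁_one_le_small {u : ℝ} (hu : |u| < (2 : ℝ) ^ 27 + 1) :
    ‖riemannZeta₁ (1 + u * I)‖ ≤
      3 / 5 * ((2 : ℝ) ^ 27 + 1) * Real.log ((2 : ℝ) ^ 27 + 1) ^ (1 : ℝ) := by
  rw [Real.rpow_one]
  have hL : 18.71 ≤ Real.log ((2 : ℝ) ^ 27 + 1) :=
    log_two_pow_27_ge.trans (Real.log_le_log (by norm_num) (by norm_num))
  have hRHS : (1.5e9 : ℝ) ≤ 3 / 5 * ((2 : ℝ) ^ 27 + 1) * Real.log ((2 : ℝ) ^ 27 + 1) := by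
    nlinarith
  rcases lt_or_ge |u| 3 with h3 | h3
  · -- crude
    have h := norm_riemannZeta₁_le_exp (c := 2) (by norm_num) (z := 1 + u * I) (by norm_num)
      (by norm_num)
    refine h.trans (le_trans ?_ hRHS)
    have h1 : Real.exp (2 * |(1 + u * I : ℂ).im|) ≤ Real.exp 6 := by
      apply Real.exp_le_exp.2; simp; linarith [h3.le]
    have h2 : Real.exp (2 * 2 + 2) = Real.exp 6 := by norm_num
    have h6 : Real.exp 6 ≤ 404 := by
      have : Real.exp 6 = Real.exp 1 ^ 6 := by rw [← Real.exp_nat_mul]; norm_num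
      rw [this]
      have h3' := Real.exp_one_lt_d9
      calc Real.exp 1 ^ 6 ≤ 2.7182818286 ^ 6 := by gcongr
        _ ≤ 404 := by norm_num
    rw [h2] at h
    calc 3 * Real.exp (2 * 2 + 2) * Real.exp (2 * |(1 + u * I : ℂ).im|)
        ≤ 3 * Real.exp 6 * Real.exp 6 := by rw [h2]; gcongr
      _ ≤ 3 * 404 * 404 := by gcongr
      _ ≤ 1.5e9 := by norm_num
  · -- `ζ₁(1+iu) = iu ζ(1+iu)`
    have hs1 : (1 + u * I : ℂ) ≠ 1 := fun h ↦ by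
      have := congrArg Complex.im h; simp at this; rw [this] at h3; norm_num at h3
    rw [riemannZeta₁_eq_mul hs1]
    have e1 : (1 + u * I : ℂ) - 1 = u * I := by ring
    rw [norm_mul, e1, norm_mul, Complex.norm_I, mul_one, Complex.norm_real, Real.norm_eq_abs]
    -- bound `‖ζ(1+iu)‖` by a function of `|u|`
    have hζ : ‖riemannZeta (1 + u * I)‖ ≤ 1 / 2 * Real.log |u| + 1.85 + 21 * Real.log |u| * (if |u| < 403 then 1 else 0) := by
      have hlogpos : 0 < Real.log |u| := Real.log_pos (by linarith)
      by_cases h403 : |u| < 403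
      · rw [if_pos h403, mul_one]
        have h := ZetaOneLine.norm_riemannZeta_le_log (s := 1 + u * I) (by simpa using h3) (by
          simp only [add_re, one_re, mul_re, ofReal_re, I_re, mul_zero, ofReal_im, I_im, mul_one,
            sub_self, add_zero, add_im, one_im, mul_im, zero_add]
          have : 0 < 2 * Real.log |u| := by positivity
          have := one_div_pos.2 this
          linarith)
        simp only [add_im, one_im, mul_im, ofReal_re, I_im, mul_one, ofReal_im, I_re, mul_zero,
          add_zero, zero_add] at h
        linarith
      · rw [if_neg h403, mul_zero, add_zero]
        push Not at h403
        have hπ : π < 3.1416 := Real.pi_lt_d4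
        rcases le_or_gt 0 u with hu0 | hu0
        · rw [abs_of_nonneg hu0] at h403 ⊢
          exact SiegelIntegral.norm_riemannZeta_one_add_le_half_log (by nlinarith)
        · rw [abs_of_neg hu0] at h403 ⊢
          have e : (1 + u * I : ℂ) = conj (1 + (-u : ℝ) * I) := by
            apply Complex.ext <;> simp
          rw [e, riemannZeta_conj, Complex.norm_conj]
          exact SiegelIntegral.norm_riemannZeta_one_add_le_half_log (by nlinarith)
    -- monotonicity in `|u|`
    set v := |u| with hv
    have hv0 : 3 ≤ v := h3
    have hvU : v ≤ (2 : ℝ) ^ 27 + 1 := hu.le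
    have hlogv : Real.log v ≤ Real.log ((2 : ℝ) ^ 27 + 1) := Real.log_le_log (by linarith) hvU
    have hlogv0 : 0 < Real.log v := Real.log_pos (by linarith)
    by_cases h403 : v < 403
    · rw [if_pos h403, mul_one] at hζ
      have hlog403 : Real.log v ≤ 6 := by
        rw [Real.log_le_iff_le_exp (by linarith)]
        have : (403 : ℝ) ≤ Real.exp 6 := by
          have e : Real.exp 6 = Real.exp 1 ^ 6 := by rw [← Real.exp_nat_mul]; norm_num
          rw [e]
          have h3' := Real.exp_one_gt_d9
          calc (403 : ℝ) ≤ 2.7182818283 ^ 6 := by norm_num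
            _ ≤ Real.exp 1 ^ 6 := by gcongr
        linarith [h403.le]
      calc v * ‖riemannZeta (1 + u * I)‖ ≤ 403 * (1 / 2 * 6 + 1.85 + 21 * 6) := by
            apply mul_le_mul h403.le (hζ.trans (by nlinarith)) (norm_nonneg _) (by norm_num)
        _ ≤ 1.5e9 := by norm_num
        _ ≤ _ := hRHS
    · rw [if_neg h403, mul_zero, add_zero] at hζ
      have hζ' : ‖riemannZeta (1 + u * I)‖ ≤ 1 / 2 * Real.log ((2 : ℝ) ^ 27 + 1) + 1.85 := by
        have : 1 / 2 * Real.log v ≤ 1 / 2 * Real.log ((2 : ℝ) ^ 27 + 1) :=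
          mul_le_mul_of_nonneg_left hlogv (by norm_num)
        exact hζ.trans (by linarith)
      calc v * ‖riemannZeta (1 + u * I)‖ ≤ ((2 : ℝ) ^ 27 + 1) * (1 / 2 * Real.log ((2 : ℝ) ^ 27 + 1) + 1.85) :=
            mul_le_mul hvU hζ' (norm_nonneg _) (by norm_num)
        _ ≤ 3 / 5 * ((2 : ℝ) ^ 27 + 1) * Real.log ((2 : ℝ) ^ 27 + 1) := by nlinarith

/-- **`H2`**: for every real `u`, `|ζ₁(1+iu)| ≤ (3/5)|2²⁷+1+iu| log|2²⁷+1+iu|` (the edge hypothesis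
of the Trudgian-II lemmas with `(k₄,k₅,Q₀) = (3/5, 1, 2²⁷)`). [cite: HasanalizadeShenWong2022, (4.3)] -/
theorem H2_large_Q (u : ℝ) :
    ‖riemannZeta₁ (1 + u * I)‖ ≤
      3 / 5 * ‖(((2 : ℝ) ^ 27 : ℝ) : ℂ) + (1 + u * I)‖ *
        Real.log ‖(((2 : ℝ) ^ 27 : ℝ) : ℂ) + (1 + u * I)‖ ^ (1 : ℝ) :=
  norm_riemannZeta₁_one_line_le_of (by norm_num) (by norm_num) (by norm_num) (by norm_num)
    (fun t ht ↦ norm_riemannZeta_one_le_large ht) (fun u hu ↦ norm_riemannZeta₁_one_le_small hu) u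


/-! ### Regional bounds for `‖ζ₁‖` in exponential form

In all of them `N = |Q₀ + s|` with `Q₀ = 2²⁷ = 134217728` and `L` is any number `≥ log N`
(on the circles used for `S(T)`, `L = log (T + Q₀ + 4)`). -/

/-- `x^y ≤ exp(y B)` when `log x ≤ B`, `y ≥ 0`, `x > 0`. [folklore] -/
lemma rpow_le_exp_mul {x y B : ℝ} (hx : 0 < x) (hy : 0 ≤ y) (h : Real.log x ≤ B) :
    x ^ y ≤ Real.exp (y * B) := by
  rw [Real.rpow_def_of_pos hx]
  exact Real.exp_le_exp.2 (by nlinarith [mul_le_mul_of_nonneg_left h hy])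

/-- `1 < N = |Q₀ + s|` and `18.71 ≤ log N` for `Re s ≥ 0`. [folklore] -/
lemma logN_ge {s : ℂ} (hs : 0 ≤ s.re) :
    1 < ‖(134217728 : ℂ) + s‖ ∧ 18.71 ≤ Real.log ‖(134217728 : ℂ) + s‖ := by
  have hre : (134217728 : ℝ) ≤ ‖(134217728 : ℂ) + s‖ := by
    refine le_trans ?_ (re_le_norm _)
    simp; linarith
  refine ⟨by linarith, ?_⟩
  calc (18.71 : ℝ) ≤ Real.log (2 ^ 27) := log_two_pow_27_ge
    _ ≤ Real.log ‖(134217728 : ℂ) + s‖ := Real.log_le_log (by norm_num) (by norm_num at hre ⊢; linarith)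

/-- **Range `½ ≤ σ ≤ 1`** (Trudgian-II interpolation between `H1` and `H2`): with `σ = Re s`,
`N = |2²⁷ + s|`, `log N ≤ L`,
`‖ζ₁(s)‖ ≤ exp(2(1−σ)·5.7275 − 0.5107(2σ−1) + (2(27/164)(1−σ)+1) L + (2σ−1) log L)`.
[cite: HasanalizadeShenWong2022, §4.1 (3)] -/
theorem norm_riemannZeta₁_le_exp_R3 {s : ℂ} {L : ℝ} (h1 : 1 / 2 ≤ s.re) (h2 : s.re ≤ 1)
    (hL : Real.log ‖(134217728 : ℂ) + s‖ ≤ L) :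
    ‖riemannZeta₁ s‖ ≤ Real.exp (2 * (1 - s.re) * 5.7275 + (2 * s.re - 1) * (-0.5107) +
      (2 * (27 / 164) * (1 - s.re) + 1) * L + (2 * s.re - 1) * Real.log L) := by
  obtain ⟨hN1, hlogN⟩ := logN_ge (s := s) (by linarith)
  set N := ‖(134217728 : ℂ) + s‖ with hN
  have hN0 : 0 < N := by linarith
  have hlogN0 : 0 < Real.log N := by linarith
  have hL0 : 0 < L := by linarith
  have eQ : (((2 : ℝ) ^ 27 : ℝ) : ℂ) = (134217728 : ℂ) := by norm_num
  have H2 : ∀ u : ℝ, ‖riemannZeta₁ (1 + u * I)‖ ≤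
      3 / 5 * ‖((134217728 : ℝ) : ℂ) + (1 + u * I)‖ * Real.log ‖((134217728 : ℝ) : ℂ) + (1 + u * I)‖ ^ (1 : ℝ) := by
    intro u
    have h := H2_large_Q u
    rw [eQ] at h
    exact_mod_cast h
  have H1 : ∀ u : ℝ, ‖riemannZeta₁ (1 / 2 + u * I)‖ ≤
      307.098 * ‖((134217728 : ℝ) : ℂ) + (1 / 2 + u * I)‖ ^ ((27 / 164 : ℝ) + 1) *
        Real.log ‖((134217728 : ℝ) : ℂ) + (1 / 2 + u * I)‖ ^ (0 : ℝ) :=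
    fun u ↦ H1_patel (Q₀ := 134217728) (by norm_num) u
  have hk : (1 : ℝ) - 0 ≤ 27 / 164 * Real.log ‖((134217728 : ℝ) : ℂ) + s‖ := by
    have : ‖((134217728 : ℝ) : ℂ) + s‖ = N := by rw [hN]; norm_num
    rw [this]; nlinarith
  have h := norm_riemannZeta₁_le_trudgianII_half_one (k₁ := 307.098) (k₂ := 27 / 164) (k₃ := 0)
    (k₄ := 3 / 5) (k₅ := 1) (Q₀ := 134217728) (by norm_num) le_rfl (by norm_num) (by norm_num)
    (by norm_num) H1 H2 h1 h2 hk
  have eN : ‖((134217728 : ℝ) : ℂ) + s‖ = N := by rw [hN]; norm_num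
  rw [eN] at h
  refine h.trans ?_
  have hσ1 : 0 ≤ 2 * (1 - s.re) := by linarith
  have hσ2 : 0 ≤ 2 * s.re - 1 := by linarith
  -- the four factors
  have f1 : (307.098 : ℝ) ^ (2 * (1 - s.re)) ≤ Real.exp (2 * (1 - s.re) * 5.7275) :=
    rpow_le_exp_mul (by norm_num) hσ1 log_k₁_le
  have f2 : (3 / 5 : ℝ) ^ (2 * s.re - 1) ≤ Real.exp ((2 * s.re - 1) * (-0.5107)) :=
    rpow_le_exp_mul (by norm_num) hσ2 log_k₄_le
  have f3 : N ^ (2 * (27 / 164) * (1 - s.re) + 1) ≤ Real.exp ((2 * (27 / 164) * (1 - s.re) + 1) * L) :=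
    rpow_le_exp_mul hN0 (by nlinarith) hL
  have f4 : Real.log N ^ (2 * 0 * (1 - s.re) + 1 * (2 * s.re - 1)) ≤
      Real.exp ((2 * s.re - 1) * Real.log L) := by
    rw [show 2 * 0 * (1 - s.re) + 1 * (2 * s.re - 1) = 2 * s.re - 1 by ring]
    exact rpow_le_exp_mul hlogN0 hσ2 (Real.log_le_log hlogN0 hL)
  have p0 : 0 ≤ (307.098 : ℝ) ^ (2 * (1 - s.re)) := Real.rpow_nonneg (by norm_num) _
  have p1 : 0 ≤ (3 / 5 : ℝ) ^ (2 * s.re - 1) := Real.rpow_nonneg (by norm_num) _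
  have p2 : 0 ≤ N ^ (2 * (27 / 164) * (1 - s.re) + 1) := Real.rpow_nonneg hN0.le _
  have p3 : 0 ≤ Real.log N ^ (2 * 0 * (1 - s.re) + 1 * (2 * s.re - 1)) := Real.rpow_nonneg hlogN0.le _
  calc (307.098 : ℝ) ^ (2 * (1 - s.re)) * (3 / 5 : ℝ) ^ (2 * s.re - 1) *
        N ^ (2 * (27 / 164) * (1 - s.re) + 1) * Real.log N ^ (2 * 0 * (1 - s.re) + 1 * (2 * s.re - 1))
      ≤ Real.exp (2 * (1 - s.re) * 5.7275) * Real.exp ((2 * s.re - 1) * (-0.5107)) *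
        Real.exp ((2 * (27 / 164) * (1 - s.re) + 1) * L) * Real.exp ((2 * s.re - 1) * Real.log L) := by
        gcongr
    _ = _ := by rw [← Real.exp_add, ← Real.exp_add, ← Real.exp_add]

/-- `ζ(6/5) ≤ 6` (integral test). [folklore] -/
lemma re_riemannZeta_six_fifths_le : (riemannZeta ((6 / 5 : ℝ) : ℂ)).re ≤ 6 := by
  have h := re_riemannZeta_ofReal_le_sum_add (σ := 6 / 5) (by norm_num) (N := 1) le_rfl
  simp only [Finset.sum_range_one, Nat.cast_zero, zero_add, Real.one_rpow, Nat.cast_one] at h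
  have e : (1 : ℝ) + 1 / (6 / 5 - 1) = 6 := by norm_num
  rw [e] at h
  exact h

/-- **Range `1 ≤ σ ≤ 6/5`** (Trudgian-II interpolation between `H2` and `|ζ₁(6/5+it)| ≤ ζ(6/5) N`):
`‖ζ₁(s)‖ ≤ exp(5(6/5−σ)(−0.5107 + log L) + 5(σ−1)·1.7918 + L)` (`ζ(6/5) ≤ 6 ≤ e^{1.7918}`).
[cite: HasanalizadeShenWong2022, §4.1 (2)] -/
theorem norm_riemannZeta₁_le_exp_R2 {s : ℂ} {L : ℝ} (h1 : 1 ≤ s.re) (h2 : s.re ≤ 6 / 5)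
    (hL : Real.log ‖(134217728 : ℂ) + s‖ ≤ L) :
    ‖riemannZeta₁ s‖ ≤ Real.exp (5 * (6 / 5 - s.re) * (-0.5107 + Real.log L) +
      5 * (s.re - 1) * 1.7918 + L) := by
  obtain ⟨hN1, hlogN⟩ := logN_ge (s := s) (by linarith)
  set N := ‖(134217728 : ℂ) + s‖ with hN
  have hN0 : 0 < N := by linarith
  have hlogN0 : 0 < Real.log N := by linarith
  have hL0 : 0 < L := by linarith
  have eQ : (((2 : ℝ) ^ 27 : ℝ) : ℂ) = (134217728 : ℂ) := by norm_num
  have H2 : ∀ u : ℝ, ‖riemannZeta₁ (1 + u * I)‖ ≤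
      3 / 5 * ‖((134217728 : ℝ) : ℂ) + (1 + u * I)‖ * Real.log ‖((134217728 : ℝ) : ℂ) + (1 + u * I)‖ ^ (1 : ℝ) := by
    intro u
    have h := H2_large_Q u
    rw [eQ] at h
    exact_mod_cast h
  have h := norm_riemannZeta₁_le_trudgianII_one_delta (k₄ := 3 / 5) (k₅ := 1) (Q₀ := 134217728)
    (δ := 1 / 5) (by norm_num) (by norm_num) (by norm_num) (by norm_num) H2 h1 (by linarith)
  have eN : ‖((134217728 : ℝ) : ℂ) + s‖ = N := by rw [hN]; norm_num
  rw [eN] at h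
  refine h.trans ?_
  have hu : 0 ≤ (1 + 1 / 5 - s.re) / (1 / 5) := by apply div_nonneg <;> linarith
  have hv : 0 ≤ (s.re - 1) / (1 / 5) := by apply div_nonneg <;> linarith
  have eu : (1 + 1 / 5 - s.re) / (1 / 5) = 5 * (6 / 5 - s.re) := by ring
  have ev : (s.re - 1) / (1 / 5) = 5 * (s.re - 1) := by ring
  -- `ζ(6/5)`
  have hζ65 : (riemannZeta ((1 + 1 / 5 : ℝ) : ℂ)).re ≤ 6 := by
    rw [show (1 + 1 / 5 : ℝ) = 6 / 5 by norm_num]; exact re_riemannZeta_six_fifths_le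
  have hζ65pos : 0 < (riemannZeta ((1 + 1 / 5 : ℝ) : ℂ)).re :=
    lt_of_lt_of_le zero_lt_one (one_le_re_riemannZeta_ofReal (by norm_num))
  have f1 : (3 / 5 : ℝ) ^ ((1 + 1 / 5 - s.re) / (1 / 5)) ≤ Real.exp (5 * (6 / 5 - s.re) * (-0.5107)) := by
    rw [eu]; exact rpow_le_exp_mul (by norm_num) (by rw [← eu]; exact hu) log_k₄_le
  have f2 : (riemannZeta ((1 + 1 / 5 : ℝ) : ℂ)).re ^ ((s.re - 1) / (1 / 5)) ≤
      Real.exp (5 * (s.re - 1) * 1.7918) := by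
    rw [ev]
    refine rpow_le_exp_mul hζ65pos (by rw [← ev]; exact hv) ?_
    exact (Real.log_le_log hζ65pos hζ65).trans log_six_le
  have f3 : N ≤ Real.exp L := by
    have := Real.exp_log hN0; rw [← this]; exact Real.exp_le_exp.2 hL
  have f4 : Real.log N ^ (1 * ((1 + 1 / 5 - s.re) / (1 / 5))) ≤
      Real.exp (5 * (6 / 5 - s.re) * Real.log L) := by
    rw [one_mul, eu]
    exact rpow_le_exp_mul hlogN0 (by rw [← eu]; exact hu) (Real.log_le_log hlogN0 hL)
  have p0 : 0 ≤ (3 / 5 : ℝ) ^ ((1 + 1 / 5 - s.re) / (1 / 5)) := Real.rpow_nonneg (by norm_num) _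
  have p1 : 0 ≤ (riemannZeta ((1 + 1 / 5 : ℝ) : ℂ)).re ^ ((s.re - 1) / (1 / 5)) :=
    Real.rpow_nonneg hζ65pos.le _
  have p3 : 0 ≤ Real.log N ^ (1 * ((1 + 1 / 5 - s.re) / (1 / 5))) := Real.rpow_nonneg hlogN0.le _
  calc (3 / 5 : ℝ) ^ ((1 + 1 / 5 - s.re) / (1 / 5)) *
        (riemannZeta ((1 + 1 / 5 : ℝ) : ℂ)).re ^ ((s.re - 1) / (1 / 5)) * N *
        Real.log N ^ (1 * ((1 + 1 / 5 - s.re) / (1 / 5)))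
      ≤ Real.exp (5 * (6 / 5 - s.re) * (-0.5107)) * Real.exp (5 * (s.re - 1) * 1.7918) *
        Real.exp L * Real.exp (5 * (6 / 5 - s.re) * Real.log L) := by gcongr
    _ = _ := by rw [← Real.exp_add, ← Real.exp_add, ← Real.exp_add]; ring_nf

/-- **Range `σ ≥ σ' > 1`** (trivial bound): `‖ζ₁(s)‖ ≤ |s−1| ζ(σ) ≤ exp(L + g)` whenever
`log N ≤ L` and `log ζ(σ') ≤ g`, `1 < σ' ≤ Re s`. [cite: HasanalizadeShenWong2022, §4.1 (1)] -/
theorem norm_riemannZeta₁_le_exp_R1 {s : ℂ} {L g σ' : ℝ} (hσ' : 1 < σ') (h1 : σ' ≤ s.re)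
    (hL : Real.log ‖(134217728 : ℂ) + s‖ ≤ L)
    (hg : Real.log (riemannZeta (σ' : ℂ)).re ≤ g) :
    ‖riemannZeta₁ s‖ ≤ Real.exp (L + g) := by
  obtain ⟨hN1, -⟩ := logN_ge (s := s) (by linarith)
  have hs1 : s ≠ 1 := fun h ↦ by rw [h] at h1; simp at h1; linarith
  have hre : 1 < s.re := by linarith
  rw [riemannZeta₁_eq_mul hs1, norm_mul, Real.exp_add]
  have hs1N : ‖s - 1‖ ≤ ‖(134217728 : ℂ) + s‖ := by
    have h1' : ‖s - 1‖ ^ 2 ≤ ‖(134217728 : ℂ) + s‖ ^ 2 := by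
      rw [Complex.sq_norm, Complex.sq_norm, Complex.normSq_apply, Complex.normSq_apply]
      simp only [sub_re, one_re, sub_im, one_im, sub_zero, add_re, add_im]
      norm_num
      nlinarith
    exact (pow_le_pow_iff_left₀ (norm_nonneg _) (norm_nonneg _) two_ne_zero).1 h1'
  have f1 : ‖s - 1‖ ≤ Real.exp L := by
    refine hs1N.trans ?_
    have := Real.exp_log (by linarith : 0 < ‖(134217728 : ℂ) + s‖)
    rw [← this]; exact Real.exp_le_exp.2 hL
  have hζpos : 0 < (riemannZeta (σ' : ℂ)).re :=
    lt_of_lt_of_le zero_lt_one (one_le_re_riemannZeta_ofReal hσ')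
  have f2 : ‖riemannZeta s‖ ≤ Real.exp g := by
    refine (norm_riemannZeta_le_re_riemannZeta hre).trans ?_
    refine (ZetaArgBacklund.re_riemannZeta_ofReal_antitone hσ' h1).trans ?_
    rw [← Real.exp_log hζpos]
    exact Real.exp_le_exp.2 hg
  exact mul_le_mul f1 f2 (norm_nonneg _) (Real.exp_pos _).le


/-- The functional-equation step for `ζ₁`: for `s = σ + it` with `−½ ≤ σ ≤ ½`, `t ≥ 10200`, and
`s' = 1 − s̄ = (1−σ) + it`,
`‖ζ₁(s)‖ ≤ exp(0.5002) (t/2π)^{1/2−σ} ‖ζ₁(s')‖` (here `−½ ≤ σ ≤ ½`)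
(`|ζ(s)| ≤ e^{1/2}(t/2π)^{1/2−σ}|ζ(s')|`, `Literature.NumberTheory.LFunctions.ZetaArgBacklund.norm_riemannZeta_le_fe`,
and `|s−1|/|s'−1| ≤ 1 + 2/t`). [cite: HasanalizadeShenWong2022, §4.1 (4)–(5)] -/
theorem norm_riemannZeta₁_le_fe {s : ℂ} (h1 : -1 / 2 ≤ s.re) (h2 : s.re ≤ 1 / 2) (ht : 10200 ≤ s.im) :
    ‖riemannZeta₁ s‖ ≤ Real.exp 0.5002 * (s.im / (2 * π)) ^ (1 / 2 - s.re) *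
      ‖riemannZeta₁ (1 - conj s)‖ := by
  have hπ := Real.pi_pos
  set σ := s.re with hσ
  set t := s.im with htdef
  have ht0 : 0 < t := by linarith
  have es : s = (σ : ℂ) + t * I := (re_add_im s).symm
  have es' : 1 - conj s = 1 - (σ : ℂ) + t * I := by
    rw [es]; simp only [map_add, Complex.conj_ofReal, map_mul, Complex.conj_I]; ring
  have hs1 : s ≠ 1 := fun h ↦ by
    have := congrArg Complex.im h; rw [← htdef] at this; simp at this; linarith
  have hs'1 : 1 - conj s ≠ 1 := fun h ↦ by
    have := congrArg Complex.im h; simp at this; rw [← htdef] at this; linarith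
  have hfe := ZetaArgBacklund.norm_riemannZeta_le_fe (σ := σ) (t := t) (by linarith) h2
    (by rw [abs_of_pos ht0]; linarith)
  rw [← es, abs_of_pos ht0] at hfe
  have hζ' : riemannZeta (1 - (σ : ℂ) + t * I) = riemannZeta₁ (1 - conj s) / (1 - conj s - 1) := by
    rw [← es', riemannZeta₁_eq_mul hs'1, mul_div_cancel_left₀ _ (sub_ne_zero.2 hs'1)]
  rw [hζ'] at hfe
  rw [riemannZeta₁_eq_mul hs1, norm_mul]
  -- `|s − 1| ≤ (1 + 2/t)|s' − 1|`
  have hden : t ≤ ‖1 - conj s - 1‖ := by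
    have := abs_im_le_norm (1 - conj s - 1)
    simp only [sub_im, one_im, Complex.conj_im, zero_sub, sub_zero, neg_neg] at this
    rw [← htdef, abs_of_pos ht0] at this
    exact this
  have hden0 : 0 < ‖1 - conj s - 1‖ := by linarith
  have hnum : ‖s - 1‖ ≤ ‖1 - conj s - 1‖ + 2 := by
    have h := norm_sub_le (s - 1 - (1 - conj s - 1)) (-(1 - conj s - 1))
    have e1 : s - 1 - (1 - conj s - 1) - -(1 - conj s - 1) = s - 1 := by ring
    have e2 : s - 1 - (1 - conj s - 1) = ((2 * σ - 1 : ℝ) : ℂ) := by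
      rw [es]; simp only [map_add, Complex.conj_ofReal, map_mul, Complex.conj_I]; push_cast; ring
    rw [e1, norm_neg, e2, Complex.norm_real, Real.norm_eq_abs] at h
    have : |2 * σ - 1| ≤ 2 := by rw [abs_le]; constructor <;> linarith
    linarith
  have hratio : ‖s - 1‖ ≤ Real.exp 0.0002 * ‖1 - conj s - 1‖ := by
    have h1' : ‖s - 1‖ ≤ (1 + 2 / t) * ‖1 - conj s - 1‖ := by
      rw [add_mul, one_mul]
      have : 2 ≤ 2 / t * ‖1 - conj s - 1‖ := by
        rw [div_mul_eq_mul_div, le_div_iff₀ ht0]; nlinarith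
      linarith
    refine h1'.trans (mul_le_mul_of_nonneg_right ?_ (norm_nonneg _))
    have h2' : 2 / t ≤ 0.0002 := by rw [div_le_iff₀ ht0]; linarith
    linarith [Real.add_one_le_exp (0.0002 : ℝ), Real.add_one_le_exp (2 / t)]
  -- combine
  have hpow : 0 ≤ (t / (2 * π)) ^ (1 / 2 - σ) := Real.rpow_nonneg (by positivity) _
  calc ‖s - 1‖ * ‖riemannZeta s‖
      ≤ (Real.exp 0.0002 * ‖1 - conj s - 1‖) *
        (Real.exp (1 / 2) * (t / (2 * π)) ^ (1 / 2 - σ) *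
          ‖riemannZeta₁ (1 - conj s) / (1 - conj s - 1)‖) :=
        mul_le_mul hratio hfe (norm_nonneg _) (by positivity)
    _ = Real.exp 0.0002 * Real.exp (1 / 2) * (t / (2 * π)) ^ (1 / 2 - σ) *
          ‖riemannZeta₁ (1 - conj s)‖ := by
        rw [norm_div]; field_simp
    _ = Real.exp 0.5002 * (t / (2 * π)) ^ (1 / 2 - σ) * ‖riemannZeta₁ (1 - conj s)‖ := by
        rw [← Real.exp_add]; norm_num

/-- **Range `0 ≤ σ < ½`** (functional equation + the `[½,1]` bound at `s' = 1 − s̄`):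
with `log N, log N' ≤ L` (`N' = |2²⁷ + s'|`), `t = Im s ≥ 10200`,
`‖ζ₁(s)‖ ≤ exp(0.5002 + (½−σ)(L − 1.8378) + 2σ·5.7275 − 0.5107(1−2σ) + (2(27/164)σ+1)L + (1−2σ) log L)`.
[cite: HasanalizadeShenWong2022, §4.1 (4)] -/
theorem norm_riemannZeta₁_le_exp_R4a {s : ℂ} {L : ℝ} (h1 : 0 ≤ s.re) (h2 : s.re < 1 / 2)
    (ht : 10200 ≤ s.im) (hL : Real.log ‖(134217728 : ℂ) + s‖ ≤ L)
    (hL' : Real.log ‖(134217728 : ℂ) + (1 - conj s)‖ ≤ L) :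
    ‖riemannZeta₁ s‖ ≤ Real.exp (0.5002 + (1 / 2 - s.re) * (L - 1.8378) +
      (2 * s.re * 5.7275 + (1 - 2 * s.re) * (-0.5107) + (2 * (27 / 164) * s.re + 1) * L +
        (1 - 2 * s.re) * Real.log L)) := by
  have hπ := Real.pi_pos
  have ht0 : 0 < s.im := by linarith
  have hfe := norm_riemannZeta₁_le_fe (by linarith) h2.le ht
  have hs're : (1 - conj s).re = 1 - s.re := by simp
  have hR3 := norm_riemannZeta₁_le_exp_R3 (s := 1 - conj s) (by rw [hs're]; linarith)
    (by rw [hs're]; linarith) hL'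
  rw [hs're] at hR3
  -- `log t ≤ L`
  have hlogt : Real.log (s.im / (2 * π)) ≤ L - 1.8378 := by
    have htN : s.im ≤ ‖(134217728 : ℂ) + s‖ := by
      have := abs_im_le_norm ((134217728 : ℂ) + s)
      simp only [add_im] at this
      rw [show ((134217728 : ℂ)).im = 0 by norm_num, zero_add, abs_of_pos ht0] at this
      exact this
    rw [Real.log_div ht0.ne' (by positivity)]
    have := Real.log_le_log ht0 htN
    linarith [TuringBound.le_log_two_pi]
  have hpow : (s.im / (2 * π)) ^ (1 / 2 - s.re) ≤ Real.exp ((1 / 2 - s.re) * (L - 1.8378)) :=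
    rpow_le_exp_mul (by positivity) (by linarith) hlogt
  refine hfe.trans ?_
  have p1 : 0 ≤ (s.im / (2 * π)) ^ (1 / 2 - s.re) := Real.rpow_nonneg (by positivity) _
  calc Real.exp 0.5002 * (s.im / (2 * π)) ^ (1 / 2 - s.re) * ‖riemannZeta₁ (1 - conj s)‖
      ≤ Real.exp 0.5002 * Real.exp ((1 / 2 - s.re) * (L - 1.8378)) *
        Real.exp (2 * (1 - (1 - s.re)) * 5.7275 + (2 * (1 - s.re) - 1) * (-0.5107) +
          (2 * (27 / 164) * (1 - (1 - s.re)) + 1) * L + (2 * (1 - s.re) - 1) * Real.log L) := by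
        gcongr
    _ = _ := by rw [← Real.exp_add, ← Real.exp_add]; ring_nf

/-- **Range `−1/50 ≤ σ < 0`** (functional equation + the `[1, 6/5]` bound at `s' = 1 − s̄`):
`‖ζ₁(s)‖ ≤ exp(0.5002 + (½−σ)(L − 1.8378) + 5(1/5+σ)(−0.5107 + log L) − 5σ·1.7918 + L)`.
[cite: HasanalizadeShenWong2022, §4.1 (5)] -/
theorem norm_riemannZeta₁_le_exp_R4b {s : ℂ} {L : ℝ} (h1 : -1 / 50 ≤ s.re) (h2 : s.re < 0)
    (ht : 10200 ≤ s.im) (hL : Real.log ‖(134217728 : ℂ) + s‖ ≤ L)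
    (hL' : Real.log ‖(134217728 : ℂ) + (1 - conj s)‖ ≤ L) :
    ‖riemannZeta₁ s‖ ≤ Real.exp (0.5002 + (1 / 2 - s.re) * (L - 1.8378) +
      (5 * (1 / 5 + s.re) * (-0.5107 + Real.log L) + 5 * (-s.re) * 1.7918 + L)) := by
  have hπ := Real.pi_pos
  have ht0 : 0 < s.im := by linarith
  have hfe := norm_riemannZeta₁_le_fe (by linarith) (by linarith) ht
  have hs're : (1 - conj s).re = 1 - s.re := by simp
  have hR2 := norm_riemannZeta₁_le_exp_R2 (s := 1 - conj s) (by rw [hs're]; linarith)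
    (by rw [hs're]; linarith) hL'
  rw [hs're] at hR2
  have hlogt : Real.log (s.im / (2 * π)) ≤ L - 1.8378 := by
    have htN : s.im ≤ ‖(134217728 : ℂ) + s‖ := by
      have := abs_im_le_norm ((134217728 : ℂ) + s)
      simp only [add_im] at this
      rw [show ((134217728 : ℂ)).im = 0 by norm_num, zero_add, abs_of_pos ht0] at this
      exact this
    rw [Real.log_div ht0.ne' (by positivity)]
    have := Real.log_le_log ht0 htN
    linarith [TuringBound.le_log_two_pi]
  have hpow : (s.im / (2 * π)) ^ (1 / 2 - s.re) ≤ Real.exp ((1 / 2 - s.re) * (L - 1.8378)) :=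
    rpow_le_exp_mul (by positivity) (by linarith) hlogt
  refine hfe.trans ?_
  have p1 : 0 ≤ (s.im / (2 * π)) ^ (1 / 2 - s.re) := Real.rpow_nonneg (by positivity) _
  calc Real.exp 0.5002 * (s.im / (2 * π)) ^ (1 / 2 - s.re) * ‖riemannZeta₁ (1 - conj s)‖
      ≤ Real.exp 0.5002 * Real.exp ((1 / 2 - s.re) * (L - 1.8378)) *
        Real.exp (5 * (6 / 5 - (1 - s.re)) * (-0.5107 + Real.log L) +
          5 * ((1 - s.re) - 1) * 1.7918 + L) := by
        gcongr
    _ = _ := by rw [← Real.exp_add, ← Real.exp_add]; ring_nf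


/-! ### The majorant on the circles: `log |ζ₁| ≤ α(σ) L + β(σ) log L + γ(σ)` -/

/-- `log ζ(q) ≤ log (q/(q−1))` for `q > 1` (integral test). [folklore] -/
lemma log_re_riemannZeta_le_crude {q : ℝ} (hq : 1 < q) :
    Real.log (riemannZeta (q : ℂ)).re ≤ Real.log (q / (q - 1)) := by
  have h := re_riemannZeta_ofReal_le_sum_add (σ := q) hq (N := 1) le_rfl
  simp only [Finset.sum_range_one, Nat.cast_zero, zero_add, Real.one_rpow, Nat.cast_one] at h
  have hpos : 0 < (riemannZeta (q : ℂ)).re := lt_of_lt_of_le zero_lt_one (one_le_re_riemannZeta_ofReal hq)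
  refine Real.log_le_log hpos (h.trans (le_of_eq ?_))
  have hq1 : q - 1 ≠ 0 := by linarith
  field_simp
  ring

/-- `log 3 ≤ 1.0987`, `log 4 ≤ 1.3863`, `log 5 ≤ 1.6095`. [folklore] -/
lemma log_three_four_five_le :
    Real.log 3 ≤ 1.0987 ∧ Real.log 4 ≤ 1.3863 ∧ Real.log 5 ≤ 1.6095 := by
  have hl2 := Real.log_two_lt_d9
  have hl2' := Real.log_two_gt_d9
  refine ⟨?_, ?_, ?_⟩
  · rw [Real.log_le_iff_le_exp (by norm_num)]
    have h1 : Real.exp 1.0987 = Real.exp 1 * Real.exp 0.0987 := by rw [← Real.exp_add]; norm_num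
    have h2 : (1.10373 : ℝ) ≤ Real.exp 0.0987 := by
      refine le_trans ?_ (Real.sum_le_exp_of_nonneg (by norm_num) 5)
      norm_num [Finset.sum_range_succ, Nat.factorial]
    rw [h1]; nlinarith [Real.exp_one_gt_d9, Real.exp_pos 0.0987]
  · have : Real.log 4 = 2 * Real.log 2 := by
      rw [show (4 : ℝ) = 2 ^ 2 by norm_num, Real.log_pow]; norm_num
    rw [this]; linarith
  · rw [Real.log_le_iff_le_exp (by norm_num)]
    have h1 : Real.exp 1.6095 = Real.exp 1 * Real.exp 0.6095 := by rw [← Real.exp_add]; norm_num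
    have h2 : (1.83949 : ℝ) ≤ Real.exp 0.6095 := by
      refine le_trans ?_ (Real.sum_le_exp_of_nonneg (by norm_num) 7)
      norm_num [Finset.sum_range_succ, Nat.factorial]
    rw [h1]; nlinarith [Real.exp_one_gt_d9, Real.exp_pos 0.6095]

/-- **The pointwise majorant.** With the coefficient functions `α, β, γ` spelled out by `hα`, `hβ`,
`hγ` (variables, to stay definition-free): for `Re w ≥ −1/50`, `Im w ≥ 10200`, `L ≥ 24` with
`log|2²⁷ + w| ≤ L` and `log|2²⁷ + (1 − w̄)| ≤ L`,
`‖ζ₁(w)‖ ≤ exp(α(σ) L + β(σ) log L + γ(σ))`, `σ = Re w` — the ranges `R4b, R4a, R3, R2, R1` of this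
file, `R1` with the trivial steps `log ζ(σ) ≤ log 6, log 5, log 4, log 3` on
`(6/5,5/4), [5/4,4/3), [4/3,3/2), [3/2,∞)`. [cite: HasanalizadeShenWong2022, §4.2] -/
theorem norm_riemannZeta₁_le_exp_abg {αf βf γf : ℝ → ℝ}
    (hα : αf = fun σ ↦ if σ < 0 then 3 / 2 - σ else if σ < 1 / 2 then 3 / 2 - σ + 27 / 82 * σ
      else if σ ≤ 1 then 27 / 82 * (1 - σ) + 1 else 1)
    (hβ : βf = fun σ ↦ if σ < 0 then 1 + 5 * σ else if σ < 1 / 2 then 1 - 2 * σ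
      else if σ ≤ 1 then 2 * σ - 1 else if σ ≤ 6 / 5 then 6 - 5 * σ else 0)
    (hγ : γf = fun σ ↦ if σ < 0 then 0.5002 - (1 / 2 - σ) * 1.8378 + 5 * (1 / 5 + σ) * (-0.5107)
        + 5 * (-σ) * 1.7918
      else if σ < 1 / 2 then 0.5002 - (1 / 2 - σ) * 1.8378 + 2 * σ * 5.7275 + (1 - 2 * σ) * (-0.5107)
      else if σ ≤ 1 then 2 * (1 - σ) * 5.7275 + (2 * σ - 1) * (-0.5107)
      else if σ ≤ 6 / 5 then 5 * (6 / 5 - σ) * (-0.5107) + 5 * (σ - 1) * 1.7918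
      else if σ < 5 / 4 then 1.7918 else if σ < 4 / 3 then 1.6095 else if σ < 3 / 2 then 1.3863
      else 1.0987)
    {w : ℂ} {L : ℝ} (hL : 24 ≤ L) (hre : -1 / 50 ≤ w.re) (him : 10200 ≤ w.im)
    (hN : Real.log ‖(134217728 : ℂ) + w‖ ≤ L)
    (hN' : Real.log ‖(134217728 : ℂ) + (1 - conj w)‖ ≤ L) :
    ‖riemannZeta₁ w‖ ≤ Real.exp (αf w.re * L + βf w.re * Real.log L + γf w.re) := by
  subst hα hβ hγ
  dsimp only
  have hL0 : 0 < Real.log L := Real.log_pos (by linarith)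
  by_cases c1 : w.re < 0
  · simp only [if_pos c1]
    refine (norm_riemannZeta₁_le_exp_R4b hre c1 him hN hN').trans (le_of_eq ?_)
    congr 1; ring
  simp only [if_neg c1]
  push Not at c1
  by_cases c2 : w.re < 1 / 2
  · simp only [if_pos c2]
    refine (norm_riemannZeta₁_le_exp_R4a c1 c2 him hN hN').trans (le_of_eq ?_)
    congr 1; ring
  simp only [if_neg c2]
  push Not at c2
  by_cases c3 : w.re ≤ 1
  · simp only [if_pos c3]
    refine (norm_riemannZeta₁_le_exp_R3 c2 c3 hN).trans (le_of_eq ?_)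
    congr 1; ring
  simp only [if_neg c3]
  push Not at c3
  by_cases c4 : w.re ≤ 6 / 5
  · simp only [if_pos c4]
    refine (norm_riemannZeta₁_le_exp_R2 c3.le c4 hN).trans (le_of_eq ?_)
    congr 1; ring
  simp only [if_neg c4]
  push Not at c4
  obtain ⟨l3, l4, l5⟩ := log_three_four_five_le
  -- `R1` with the trivial steps
  have key : ∀ {q G : ℝ}, 1 < q → q ≤ w.re → Real.log (q / (q - 1)) ≤ G →
      ‖riemannZeta₁ w‖ ≤ Real.exp (1 * L + 0 * Real.log L + G) := by
    intro q G hq hqw hG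
    rw [one_mul, zero_mul, add_zero]
    exact norm_riemannZeta₁_le_exp_R1 hq hqw hN ((log_re_riemannZeta_le_crude hq).trans hG)
  by_cases c5 : w.re < 5 / 4
  · simp only [if_pos c5]
    exact key (q := 6 / 5) (by norm_num) c4.le
      (by rw [show (6 / 5 : ℝ) / (6 / 5 - 1) = 6 by norm_num]; exact log_six_le)
  simp only [if_neg c5]
  push Not at c5
  by_cases c6 : w.re < 4 / 3
  · simp only [if_pos c6]
    exact key (q := 5 / 4) (by norm_num) c5
      (by rw [show (5 / 4 : ℝ) / (5 / 4 - 1) = 5 by norm_num]; exact l5)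
  simp only [if_neg c6]
  push Not at c6
  by_cases c7 : w.re < 3 / 2
  · simp only [if_pos c7]
    exact key (q := 4 / 3) (by norm_num) c6
      (by rw [show (4 / 3 : ℝ) / (4 / 3 - 1) = 4 by norm_num]; exact l4)
  simp only [if_neg c7]
  push Not at c7
  exact key (q := 3 / 2) (by norm_num) c7
    (by rw [show (3 / 2 : ℝ) / (3 / 2 - 1) = 3 by norm_num]; exact l3)


/-! ### The circle `σ = 1.01 + 1.02 cos θ`: enclosures of the break angles -/

/-- `π/2` to seven places. [folklore] -/
lemma pi_div_two_bounds : 1.5707963 < π / 2 ∧ π / 2 < 1.5707965 := by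
  constructor <;> linarith [Real.pi_gt_d20, Real.pi_lt_d20]

/-- **`θ₁ = arccos(−1/102)`** (the angle of `σ = 1`): `θ₁ = π/2 + arcsin(1/102)` with
`1/102 ≤ arcsin(1/102) ≤ 0.00981`. [folklore] -/
lemma theta_one_bounds :
    π / 2 + 1 / 102 ≤ Real.arccos (-1 / 102) ∧ Real.arccos (-1 / 102) ≤ π / 2 + 0.00981 := by
  have e : Real.arccos (-1 / 102) = π / 2 + Real.arcsin (1 / 102) := by
    rw [show (-1 / 102 : ℝ) = -(1 / 102) by norm_num, Real.arccos_neg,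
      Real.arccos_eq_pi_div_two_sub_arcsin]; ring
  rw [e]
  have hπ2 := pi_div_two_bounds
  have h1 : 1 / 102 ≤ Real.arcsin (1 / 102) := by
    rw [Real.le_arcsin_iff_sin_le ⟨by linarith, by linarith⟩ ⟨by norm_num, by norm_num⟩]
    exact Real.sin_le (by norm_num)
  have h2 : Real.arcsin (1 / 102) ≤ 0.00981 := by
    rw [Real.arcsin_le_iff_le_sin ⟨by norm_num, by norm_num⟩ ⟨by linarith, by linarith⟩]
    have := Real.sin_gt_sub_cube (x := 0.00981) (by norm_num)
    norm_num at this ⊢; linarith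
  constructor <;> linarith

/-- `sin θ₁ = √(1 − 1/102²) ∈ [0.99995, 0.999952]`, `cos θ₁ = −1/102`. [folklore] -/
lemma sin_cos_theta_one :
    Real.cos (Real.arccos (-1 / 102)) = -1 / 102 ∧
      0.99995 ≤ Real.sin (Real.arccos (-1 / 102)) ∧ Real.sin (Real.arccos (-1 / 102)) ≤ 0.999952 := by
  refine ⟨Real.cos_arccos (by norm_num) (by norm_num), ?_, ?_⟩
  · rw [Real.sin_arccos, Real.le_sqrt (by norm_num)] <;> norm_num
  · rw [Real.sin_arccos]
    calc Real.sqrt (1 - (-1 / 102) ^ 2) ≤ Real.sqrt (0.999952 ^ 2) := Real.sqrt_le_sqrt (by norm_num)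
      _ = 0.999952 := Real.sqrt_sq (by norm_num)

/-- **`θ₀ = arccos(−101/102)`** (the angle of `σ = 0`): `π − 0.1403 ≤ θ₀ ≤ π − 0.14`
(`cos 0.14 ≥ 1 − 0.14²/2 ≥ 101/102 ≥ cos 0.1403`). [folklore] -/
lemma theta_zero_bounds :
    π - 0.1403 ≤ Real.arccos (-101 / 102) ∧ Real.arccos (-101 / 102) ≤ π - 0.14 := by
  have e : Real.arccos (-101 / 102) = π - Real.arccos (101 / 102) := by
    rw [show (-101 / 102 : ℝ) = -(101 / 102) by norm_num, Real.arccos_neg]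
  rw [e]
  have h1 : 0.14 ≤ Real.arccos (101 / 102) := by
    have hc : (101 / 102 : ℝ) ≤ Real.cos 0.14 := by
      have := Real.one_sub_sq_div_two_le_cos (x := 0.14); norm_num at this ⊢; linarith
    have := Real.arccos_le_arccos hc
    rwa [Real.arccos_cos (by norm_num) (by linarith [Real.pi_gt_three])] at this
  have h2 : Real.arccos (101 / 102) ≤ 0.1403 := by
    have hc : Real.cos 0.1403 ≤ 101 / 102 := by
      have := Real.cos_bound (x := 0.1403) (by norm_num)
      rw [abs_le] at this
      norm_num at this ⊢; linarith [this.2]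
    have := Real.arccos_le_arccos hc
    rwa [Real.arccos_cos (by norm_num) (by linarith [Real.pi_gt_three])] at this
  constructor <;> linarith

/-- `sin θ₀ = √(1 − (101/102)²) ∈ [0.139684, 0.139685]`, `cos θ₀ = −101/102`. [folklore] -/
lemma sin_cos_theta_zero :
    Real.cos (Real.arccos (-101 / 102)) = -101 / 102 ∧
      0.139684 ≤ Real.sin (Real.arccos (-101 / 102)) ∧
        Real.sin (Real.arccos (-101 / 102)) ≤ 0.139685 := by
  refine ⟨Real.cos_arccos (by norm_num) (by norm_num), ?_, ?_⟩
  · rw [Real.sin_arccos, Real.le_sqrt (by norm_num)] <;> norm_num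
  · rw [Real.sin_arccos]
    calc Real.sqrt (1 - (-101 / 102) ^ 2) ≤ Real.sqrt (0.139685 ^ 2) := Real.sqrt_le_sqrt (by norm_num)
      _ = 0.139685 := Real.sqrt_sq (by norm_num)

/-- At the node `θ* = 1.384` (just past `θ_{6/5}`): `cos 1.384 ≤ 19/102` (so `σ(θ) ≤ 6/5` beyond
it) and `0.98255 ≤ sin 1.384 ≤ 0.98262`. [folklore] -/
lemma cos_sin_node_1384 :
    Real.cos 1.384 ≤ 19 / 102 ∧ 0 < Real.cos 1.384 ∧
      0.98255 ≤ Real.sin 1.384 ∧ Real.sin 1.384 ≤ 0.98262 := by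
  have hπ2 := pi_div_two_bounds
  set y := π / 2 - 1.384 with hy
  have hy1 : 0.1867963 < y := by rw [hy]; linarith
  have hy2 : y < 0.1867965 := by rw [hy]; linarith
  have hcos : Real.cos 1.384 = Real.sin y := by rw [hy, Real.sin_pi_div_two_sub]
  have hsin : Real.sin 1.384 = Real.cos y := by rw [hy, Real.cos_pi_div_two_sub]
  have hyabs : |y| ≤ 1 := by rw [abs_le]; constructor <;> linarith
  have hsb := Real.sin_bound hyabs
  have hcb := Real.cos_bound hyabs
  rw [abs_le] at hsb hcb
  rw [abs_of_pos (by linarith)] at hsb hcb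
  have hy4 : y ^ 4 ≤ 0.1867965 ^ 4 := by
    have : 0 ≤ y := by linarith
    nlinarith [pow_le_pow_left₀ this hy2.le 4]
  have hy3 : y ^ 3 ≥ 0.1867963 ^ 3 := by nlinarith
  have hy3' : y ^ 3 ≤ 0.1867965 ^ 3 := by nlinarith
  have hy2u : y ^ 2 ≤ 0.1867965 ^ 2 := by nlinarith
  have hy2l : 0.1867963 ^ 2 ≤ y ^ 2 := by nlinarith
  refine ⟨?_, ?_, ?_, ?_⟩
  · rw [hcos]; norm_num at hsb hy4 hy3 ⊢; nlinarith [hsb.2]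
  · rw [hcos]; exact Real.sin_pos_of_pos_of_lt_pi (by linarith) (by linarith [Real.pi_gt_three])
  · rw [hsin]; have := Real.one_sub_sq_div_two_le_cos (x := y); norm_num at hy2u ⊢; nlinarith
  · rw [hsin]; norm_num at hcb hy4 hy2l ⊢; nlinarith [hcb.2]

/-- Lower bounds for `cos` at the `R1` nodes: `cos 1.33 ≥ 4/17`, `cos 1.24 ≥ 0.317`,
`cos 1.05 ≥ 0.4804` (so `σ ≥ 5/4, 4/3, 3/2` there; `sin y ≥ y − y³/6`). [folklore] -/
lemma cos_nodes_ge :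
    (4 / 17 : ℝ) ≤ Real.cos 1.33 ∧ (0.317 : ℝ) ≤ Real.cos 1.24 ∧ (0.4804 : ℝ) ≤ Real.cos 1.05 := by
  have hπ2 := pi_div_two_bounds
  have key : ∀ (t a y0 y1 : ℝ), y0 ≤ π / 2 - t → π / 2 - t ≤ y1 → 0 ≤ y0 → y1 ≤ 1 →
      a ≤ y0 - y1 ^ 3 / 6 → a ≤ Real.cos t := by
    intro t a y0 y1 h0 h1 hy0 hy1 ha
    rw [← Real.sin_pi_div_two_sub]
    have hy : 0 ≤ π / 2 - t := by linarith
    refine le_trans ?_ (Real.sin_ge_sub_cube hy)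
    have h3 : (π / 2 - t) ^ 3 ≤ y1 ^ 3 := pow_le_pow_left₀ hy h1 3
    linarith
  refine ⟨key 1.33 _ 0.2407963 0.2407965 (by linarith) (by linarith) (by norm_num) (by norm_num)
      (by norm_num),
    key 1.24 _ 0.3307963 0.3307965 (by linarith) (by linarith) (by norm_num) (by norm_num) (by norm_num),
    key 1.05 _ 0.5207963 0.5207965 (by linarith) (by linarith) (by norm_num) (by norm_num)
      (by norm_num)⟩


/-! ### Position on the circle versus `σ = 1.01 + 1.02 cos θ` -/

section sigma
variable {x : ℝ}

/-- `σ(θ) > 1` before `θ₁`. [folklore] -/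
lemma sigma_gt_one (hx0 : 0 ≤ x) (hx : x < Real.arccos (-1 / 102)) :
    1 < 101 / 100 + 51 / 50 * Real.cos x := by
  have h := Real.cos_lt_cos_of_nonneg_of_le_pi hx0 (Real.arccos_le_pi _) hx
  rw [sin_cos_theta_one.1] at h; linarith

/-- `σ(θ) < 1` after `θ₁`. [folklore] -/
lemma sigma_lt_one (hxπ : x ≤ π) (hx : Real.arccos (-1 / 102) < x) :
    101 / 100 + 51 / 50 * Real.cos x < 1 := by
  have h := Real.cos_lt_cos_of_nonneg_of_le_pi (Real.arccos_nonneg _) hxπ hx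
  rw [sin_cos_theta_one.1] at h; linarith

/-- `σ(θ) > ½` before `2π/3`. [folklore] -/
lemma sigma_gt_half (hx0 : 0 ≤ x) (hx : x < 2 * π / 3) :
    1 / 2 < 101 / 100 + 51 / 50 * Real.cos x := by
  have h := Real.cos_lt_cos_of_nonneg_of_le_pi hx0 (by linarith [Real.pi_pos]) hx
  rw [ZetaArgBacklund.cos_two_pi_div_three] at h; linarith

/-- `σ(θ) < ½` after `2π/3`. [folklore] -/
lemma sigma_lt_half (hxπ : x ≤ π) (hx : 2 * π / 3 < x) :
    101 / 100 + 51 / 50 * Real.cos x < 1 / 2 := by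
  have h := Real.cos_lt_cos_of_nonneg_of_le_pi (by linarith [Real.pi_pos]) hxπ hx
  rw [ZetaArgBacklund.cos_two_pi_div_three] at h; linarith

/-- `σ(θ) > 0` before `θ₀`. [folklore] -/
lemma sigma_pos (hx0 : 0 ≤ x) (hx : x < Real.arccos (-101 / 102)) :
    0 < 101 / 100 + 51 / 50 * Real.cos x := by
  have h := Real.cos_lt_cos_of_nonneg_of_le_pi hx0 (Real.arccos_le_pi _) hx
  rw [sin_cos_theta_zero.1] at h; linarith

/-- `σ(θ) < 0` after `θ₀`. [folklore] -/
lemma sigma_neg (hxπ : x ≤ π) (hx : Real.arccos (-101 / 102) < x) :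
    101 / 100 + 51 / 50 * Real.cos x < 0 := by
  have h := Real.cos_lt_cos_of_nonneg_of_le_pi (Real.arccos_nonneg _) hxπ hx
  rw [sin_cos_theta_zero.1] at h; linarith

/-- `σ(θ) ≤ 6/5` from `θ = 1.384` on. [folklore] -/
lemma sigma_le_six_fifths (hxπ : x ≤ π) (hx : 1.384 ≤ x) :
    101 / 100 + 51 / 50 * Real.cos x ≤ 6 / 5 := by
  have h := Real.cos_le_cos_of_nonneg_of_le_pi (by norm_num) hxπ hx
  linarith [cos_sin_node_1384.1]

/-- `σ(θ) ≥ 1.199` up to `θ = 1.384` (`cos 1.384 ≥ 0.1857`). [folklore] -/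
lemma sigma_ge_of_le_1384 (hx0 : 0 ≤ x) (hx : x ≤ 1.384) :
    1.199 ≤ 101 / 100 + 51 / 50 * Real.cos x := by
  have h := Real.cos_le_cos_of_nonneg_of_le_pi hx0 (by linarith [Real.pi_gt_three]) hx
  have hc : 0.1857 ≤ Real.cos 1.384 := by
    have hπ2 := pi_div_two_bounds
    rw [← Real.sin_pi_div_two_sub]
    have hy : 0 ≤ π / 2 - 1.384 := by linarith
    refine le_trans ?_ (Real.sin_ge_sub_cube hy)
    have h3 : (π / 2 - 1.384) ^ 3 ≤ 0.1867965 ^ 3 := pow_le_pow_left₀ hy (by linarith) 3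
    linarith
  linarith

/-- `σ(θ) ≥ 5/4` up to `θ = 1.33`. [folklore] -/
lemma sigma_ge_five_fourths (hx0 : 0 ≤ x) (hx : x ≤ 1.33) :
    5 / 4 ≤ 101 / 100 + 51 / 50 * Real.cos x := by
  have h := Real.cos_le_cos_of_nonneg_of_le_pi hx0 (by linarith [Real.pi_gt_three]) hx
  linarith [cos_nodes_ge.1]

/-- `σ(θ) ≥ 4/3` up to `θ = 1.24`. [folklore] -/
lemma sigma_ge_four_thirds (hx0 : 0 ≤ x) (hx : x ≤ 1.24) :
    4 / 3 ≤ 101 / 100 + 51 / 50 * Real.cos x := by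
  have h := Real.cos_le_cos_of_nonneg_of_le_pi hx0 (by linarith [Real.pi_gt_three]) hx
  linarith [cos_nodes_ge.2.1]

/-- `σ(θ) ≥ 3/2` up to `θ = 1.05`. [folklore] -/
lemma sigma_ge_three_halves (hx0 : 0 ≤ x) (hx : x ≤ 1.05) :
    3 / 2 ≤ 101 / 100 + 51 / 50 * Real.cos x := by
  have h := Real.cos_le_cos_of_nonneg_of_le_pi hx0 (by linarith [Real.pi_gt_three]) hx
  linarith [cos_nodes_ge.2.2]

/-- `−1/50 ≤ σ(θ) ≤ 2.03` for all `θ`. [folklore] -/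
lemma sigma_mem (x : ℝ) : -1 / 50 ≤ 101 / 100 + 51 / 50 * Real.cos x ∧
    101 / 100 + 51 / 50 * Real.cos x ≤ 203 / 100 := by
  constructor <;> nlinarith [Real.cos_le_one x, Real.neg_one_le_cos x]

/-- The break angles in increasing order: `1.384 < θ₁ < 2π/3 < θ₀ < π`. [folklore] -/
lemma angles_ordered : 1.384 < Real.arccos (-1 / 102) ∧ Real.arccos (-1 / 102) < 2 * π / 3 ∧
    2 * π / 3 < Real.arccos (-101 / 102) ∧ Real.arccos (-101 / 102) < π := by
  have h1 := theta_one_bounds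
  have h0 := theta_zero_bounds
  have hπ := pi_div_two_bounds
  refine ⟨by linarith, by linarith, by linarith, by linarith⟩

end sigma

/-! ### The coefficient functions along the arcs -/

section arcs
variable {αf βf γf : ℝ → ℝ}

/-- `α` on the arcs. [folklore] -/
lemma alpha_arcs
    (hα : αf = fun σ ↦ if σ < 0 then 3 / 2 - σ else if σ < 1 / 2 then 3 / 2 - σ + 27 / 82 * σ
      else if σ ≤ 1 then 27 / 82 * (1 - σ) + 1 else 1) {x : ℝ} (hx0 : 0 ≤ x) (hxπ : x ≤ π) :
    (x < Real.arccos (-1 / 102) → αf (101 / 100 + 51 / 50 * Real.cos x) = 1) ∧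
    (Real.arccos (-1 / 102) < x → x < 2 * π / 3 →
      αf (101 / 100 + 51 / 50 * Real.cos x) = 27 / 82 * (1 - (101 / 100 + 51 / 50 * Real.cos x)) + 1) ∧
    (2 * π / 3 < x → x < Real.arccos (-101 / 102) →
      αf (101 / 100 + 51 / 50 * Real.cos x) =
        3 / 2 - (101 / 100 + 51 / 50 * Real.cos x) + 27 / 82 * (101 / 100 + 51 / 50 * Real.cos x)) ∧
    (Real.arccos (-101 / 102) < x →
      αf (101 / 100 + 51 / 50 * Real.cos x) = 3 / 2 - (101 / 100 + 51 / 50 * Real.cos x)) := by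
  subst hα
  have hord := angles_ordered
  refine ⟨fun h1 ↦ ?_, fun h1 h2 ↦ ?_, fun h1 h2 ↦ ?_, fun h1 ↦ ?_⟩ <;> dsimp only
  · have := sigma_gt_one hx0 h1
    rw [if_neg (by linarith), if_neg (by linarith), if_neg (by linarith)]
  · have := sigma_lt_one hxπ h1; have := sigma_gt_half hx0 h2
    rw [if_neg (by linarith), if_neg (by linarith), if_pos (by linarith)]
  · have := sigma_lt_half hxπ h1; have := sigma_pos hx0 h2
    rw [if_neg (by linarith), if_pos (by linarith)]
  · have := sigma_neg hxπ h1
    rw [if_pos (by linarith)]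

/-- `β` on the arcs. [folklore] -/
lemma beta_arcs
    (hβ : βf = fun σ ↦ if σ < 0 then 1 + 5 * σ else if σ < 1 / 2 then 1 - 2 * σ
      else if σ ≤ 1 then 2 * σ - 1 else if σ ≤ 6 / 5 then 6 - 5 * σ else 0)
    {x : ℝ} (hx0 : 0 ≤ x) (hxπ : x ≤ π) :
    (x ≤ 1.33 → βf (101 / 100 + 51 / 50 * Real.cos x) = 0) ∧
    (x ≤ 1.384 → 0 ≤ βf (101 / 100 + 51 / 50 * Real.cos x) ∧
      βf (101 / 100 + 51 / 50 * Real.cos x) ≤ 0.005) ∧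
    (1.384 ≤ x → x < Real.arccos (-1 / 102) →
      βf (101 / 100 + 51 / 50 * Real.cos x) = 6 - 5 * (101 / 100 + 51 / 50 * Real.cos x)) ∧
    (Real.arccos (-1 / 102) < x → x < 2 * π / 3 →
      βf (101 / 100 + 51 / 50 * Real.cos x) = 2 * (101 / 100 + 51 / 50 * Real.cos x) - 1) ∧
    (2 * π / 3 < x → x < Real.arccos (-101 / 102) →
      βf (101 / 100 + 51 / 50 * Real.cos x) = 1 - 2 * (101 / 100 + 51 / 50 * Real.cos x)) ∧
    (Real.arccos (-101 / 102) < x →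
      βf (101 / 100 + 51 / 50 * Real.cos x) = 1 + 5 * (101 / 100 + 51 / 50 * Real.cos x)) := by
  subst hβ
  have hord := angles_ordered
  refine ⟨fun h1 ↦ ?_, fun h1 ↦ ?_, fun h1 h2 ↦ ?_, fun h1 h2 ↦ ?_, fun h1 h2 ↦ ?_, fun h1 ↦ ?_⟩ <;>
    dsimp only
  · have := sigma_ge_five_fourths hx0 h1
    rw [if_neg (by linarith), if_neg (by linarith), if_neg (by linarith), if_neg (by linarith)]
  · have := sigma_ge_of_le_1384 hx0 h1
    rw [if_neg (by linarith), if_neg (by linarith), if_neg (by linarith)]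
    split_ifs <;> constructor <;> linarith
  · have := sigma_le_six_fifths hxπ h1; have := sigma_gt_one hx0 h2
    rw [if_neg (by linarith), if_neg (by linarith), if_neg (by linarith), if_pos (by linarith)]
  · have := sigma_lt_one hxπ h1; have := sigma_gt_half hx0 h2
    rw [if_neg (by linarith), if_neg (by linarith), if_pos (by linarith)]
  · have := sigma_lt_half hxπ h1; have := sigma_pos hx0 h2
    rw [if_neg (by linarith), if_pos (by linarith)]
  · have := sigma_neg hxπ h1
    rw [if_pos (by linarith)]

/-- `γ` on the arcs. [folklore] -/
lemma gamma_arcs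
    (hγ : γf = fun σ ↦ if σ < 0 then 0.5002 - (1 / 2 - σ) * 1.8378 + 5 * (1 / 5 + σ) * (-0.5107)
        + 5 * (-σ) * 1.7918
      else if σ < 1 / 2 then 0.5002 - (1 / 2 - σ) * 1.8378 + 2 * σ * 5.7275 + (1 - 2 * σ) * (-0.5107)
      else if σ ≤ 1 then 2 * (1 - σ) * 5.7275 + (2 * σ - 1) * (-0.5107)
      else if σ ≤ 6 / 5 then 5 * (6 / 5 - σ) * (-0.5107) + 5 * (σ - 1) * 1.7918
      else if σ < 5 / 4 then 1.7918 else if σ < 4 / 3 then 1.6095 else if σ < 3 / 2 then 1.3863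
      else 1.0987) {x : ℝ} (hx0 : 0 ≤ x) (hxπ : x ≤ π) :
    (x ≤ 1.05 → γf (101 / 100 + 51 / 50 * Real.cos x) = 1.0987) ∧
    (x ≤ 1.24 → γf (101 / 100 + 51 / 50 * Real.cos x) ≤ 1.3863) ∧
    (x ≤ 1.33 → γf (101 / 100 + 51 / 50 * Real.cos x) ≤ 1.6095) ∧
    (x ≤ 1.384 → γf (101 / 100 + 51 / 50 * Real.cos x) ≤ 1.7918) ∧
    (1.384 ≤ x → x < Real.arccos (-1 / 102) →
      γf (101 / 100 + 51 / 50 * Real.cos x) = 5 * (6 / 5 - (101 / 100 + 51 / 50 * Real.cos x)) * (-0.5107)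
        + 5 * ((101 / 100 + 51 / 50 * Real.cos x) - 1) * 1.7918) ∧
    (Real.arccos (-1 / 102) < x → x < 2 * π / 3 →
      γf (101 / 100 + 51 / 50 * Real.cos x) = 2 * (1 - (101 / 100 + 51 / 50 * Real.cos x)) * 5.7275
        + (2 * (101 / 100 + 51 / 50 * Real.cos x) - 1) * (-0.5107)) ∧
    (2 * π / 3 < x → x < Real.arccos (-101 / 102) →
      γf (101 / 100 + 51 / 50 * Real.cos x) = 0.5002 - (1 / 2 - (101 / 100 + 51 / 50 * Real.cos x)) * 1.8378
        + 2 * (101 / 100 + 51 / 50 * Real.cos x) * 5.7275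
        + (1 - 2 * (101 / 100 + 51 / 50 * Real.cos x)) * (-0.5107)) ∧
    (Real.arccos (-101 / 102) < x →
      γf (101 / 100 + 51 / 50 * Real.cos x) = 0.5002 - (1 / 2 - (101 / 100 + 51 / 50 * Real.cos x)) * 1.8378
        + 5 * (1 / 5 + (101 / 100 + 51 / 50 * Real.cos x)) * (-0.5107)
        + 5 * (-(101 / 100 + 51 / 50 * Real.cos x)) * 1.7918) := by
  subst hγ
  have hord := angles_ordered
  refine ⟨fun h1 ↦ ?_, fun h1 ↦ ?_, fun h1 ↦ ?_, fun h1 ↦ ?_, fun h1 h2 ↦ ?_, fun h1 h2 ↦ ?_,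
    fun h1 h2 ↦ ?_, fun h1 ↦ ?_⟩ <;> dsimp only
  · have := sigma_ge_three_halves hx0 h1
    rw [if_neg (by linarith), if_neg (by linarith), if_neg (by linarith), if_neg (by linarith),
      if_neg (by linarith), if_neg (by linarith), if_neg (by linarith)]
  · have := sigma_ge_four_thirds hx0 h1
    rw [if_neg (by linarith), if_neg (by linarith), if_neg (by linarith), if_neg (by linarith),
      if_neg (by linarith), if_neg (by linarith)]
    split_ifs <;> norm_num
  · have := sigma_ge_five_fourths hx0 h1
    rw [if_neg (by linarith), if_neg (by linarith), if_neg (by linarith), if_neg (by linarith),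
      if_neg (by linarith)]
    split_ifs <;> norm_num
  · have := sigma_ge_of_le_1384 hx0 h1
    rw [if_neg (by linarith), if_neg (by linarith), if_neg (by linarith)]
    split_ifs <;> nlinarith
  · have := sigma_le_six_fifths hxπ h1; have := sigma_gt_one hx0 h2
    rw [if_neg (by linarith), if_neg (by linarith), if_neg (by linarith), if_pos (by linarith)]
  · have := sigma_lt_one hxπ h1; have := sigma_gt_half hx0 h2
    rw [if_neg (by linarith), if_neg (by linarith), if_pos (by linarith)]
  · have := sigma_lt_half hxπ h1; have := sigma_pos hx0 h2
    rw [if_neg (by linarith), if_pos (by linarith)]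
  · have := sigma_neg hxπ h1
    rw [if_pos (by linarith)]

end arcs


/-! ### The integral of the majorant over the half circle -/

section integral
variable {αf βf γf : ℝ → ℝ}

/-- Measurability of the three coefficient functions. [folklore] -/
lemma measurable_abg
    (hα : αf = fun σ ↦ if σ < 0 then 3 / 2 - σ else if σ < 1 / 2 then 3 / 2 - σ + 27 / 82 * σ
      else if σ ≤ 1 then 27 / 82 * (1 - σ) + 1 else 1)
    (hβ : βf = fun σ ↦ if σ < 0 then 1 + 5 * σ else if σ < 1 / 2 then 1 - 2 * σ
      else if σ ≤ 1 then 2 * σ - 1 else if σ ≤ 6 / 5 then 6 - 5 * σ else 0)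
    (hγ : γf = fun σ ↦ if σ < 0 then 0.5002 - (1 / 2 - σ) * 1.8378 + 5 * (1 / 5 + σ) * (-0.5107)
        + 5 * (-σ) * 1.7918
      else if σ < 1 / 2 then 0.5002 - (1 / 2 - σ) * 1.8378 + 2 * σ * 5.7275 + (1 - 2 * σ) * (-0.5107)
      else if σ ≤ 1 then 2 * (1 - σ) * 5.7275 + (2 * σ - 1) * (-0.5107)
      else if σ ≤ 6 / 5 then 5 * (6 / 5 - σ) * (-0.5107) + 5 * (σ - 1) * 1.7918
      else if σ < 5 / 4 then 1.7918 else if σ < 4 / 3 then 1.6095 else if σ < 3 / 2 then 1.3863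
      else 1.0987) :
    Measurable αf ∧ Measurable βf ∧ Measurable γf := by
  subst hα hβ hγ
  have mlt : ∀ a : ℝ, MeasurableSet {σ : ℝ | σ < a} := fun a ↦ measurableSet_lt measurable_id measurable_const
  have mle : ∀ a : ℝ, MeasurableSet {σ : ℝ | σ ≤ a} := fun a ↦ measurableSet_le measurable_id measurable_const
  refine ⟨?_, ?_, ?_⟩
  · refine Measurable.ite (mlt 0) (by fun_prop) (Measurable.ite (mlt _) (by fun_prop)
      (Measurable.ite (mle 1) (by fun_prop) measurable_const))
  · refine Measurable.ite (mlt 0) (by fun_prop) (Measurable.ite (mlt _) (by fun_prop)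
      (Measurable.ite (mle 1) (by fun_prop) (Measurable.ite (mle _) (by fun_prop) measurable_const)))
  · refine Measurable.ite (mlt 0) (by fun_prop) (Measurable.ite (mlt _) (by fun_prop)
      (Measurable.ite (mle 1) (by fun_prop) (Measurable.ite (mle _) (by fun_prop)
        (Measurable.ite (mlt _) measurable_const (Measurable.ite (mlt _) measurable_const
          (Measurable.ite (mlt _) measurable_const measurable_const))))))

/-- Crude bounds `1 ≤ α ≤ 2`, `0 ≤ β ≤ 1`, `|γ| ≤ 15` on `−1/50 ≤ σ ≤ 2.03`. [folklore] -/
lemma abg_bounds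
    (hα : αf = fun σ ↦ if σ < 0 then 3 / 2 - σ else if σ < 1 / 2 then 3 / 2 - σ + 27 / 82 * σ
      else if σ ≤ 1 then 27 / 82 * (1 - σ) + 1 else 1)
    (hβ : βf = fun σ ↦ if σ < 0 then 1 + 5 * σ else if σ < 1 / 2 then 1 - 2 * σ
      else if σ ≤ 1 then 2 * σ - 1 else if σ ≤ 6 / 5 then 6 - 5 * σ else 0)
    (hγ : γf = fun σ ↦ if σ < 0 then 0.5002 - (1 / 2 - σ) * 1.8378 + 5 * (1 / 5 + σ) * (-0.5107)
        + 5 * (-σ) * 1.7918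
      else if σ < 1 / 2 then 0.5002 - (1 / 2 - σ) * 1.8378 + 2 * σ * 5.7275 + (1 - 2 * σ) * (-0.5107)
      else if σ ≤ 1 then 2 * (1 - σ) * 5.7275 + (2 * σ - 1) * (-0.5107)
      else if σ ≤ 6 / 5 then 5 * (6 / 5 - σ) * (-0.5107) + 5 * (σ - 1) * 1.7918
      else if σ < 5 / 4 then 1.7918 else if σ < 4 / 3 then 1.6095 else if σ < 3 / 2 then 1.3863
      else 1.0987) {σ : ℝ} (h1 : -1 / 50 ≤ σ) (h2 : σ ≤ 203 / 100) :
    (1 ≤ αf σ ∧ αf σ ≤ 2) ∧ (0 ≤ βf σ ∧ βf σ ≤ 1) ∧ |γf σ| ≤ 15 := by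
  subst hα hβ hγ
  dsimp only
  refine ⟨?_, ?_, ?_⟩
  · split_ifs <;> constructor <;> linarith
  · split_ifs <;> constructor <;> linarith
  · rw [abs_le]; split_ifs <;> constructor <;> nlinarith

/-- The twelve per-arc numerical bounds, linear in the enclosed quantities
`θ₁, θ₀, sin θ₁, sin θ₀, sin 1.384, √3`. [folklore] -/
lemma arc_numerics {θ₁ θ₀ s₁ s₀ ss r3 : ℝ} (h1l : π / 2 + 1 / 102 ≤ θ₁) (h1u : θ₁ ≤ π / 2 + 0.00981)
    (h0l : π - 0.1403 ≤ θ₀) (h0u : θ₀ ≤ π - 0.14) (s1l : 0.99995 ≤ s₁) (s1u : s₁ ≤ 0.999952)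
    (s0l : 0.139684 ≤ s₀) (s0u : s₀ ≤ 0.139685) (ssl : 0.98255 ≤ ss) (ssu : ss ≤ 0.98262)
    (r3l : 1.7320508 < r3) (r3u : r3 < 1.7320509) :
    1 * (θ₁ - 1.384) ≤ 0.1967 ∧
    (6 - 5 * (101 / 100)) * (θ₁ - 1.384) + 51 / 50 * (-5) * (s₁ - ss) ≤ 0.0984 ∧
    (5 * (6 / 5 - 101 / 100) * (-0.5107) + 5 * (101 / 100 - 1) * 1.7918) * (θ₁ - 1.384) +
      51 / 50 * (5 * 0.5107 + 5 * 1.7918) * (s₁ - ss) ≤ 0.1266 ∧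
    (27 / 82 * (1 - 101 / 100) + 1) * (2 * π / 3 - θ₁) + 51 / 50 * (-(27 / 82)) * (r3 / 2 - s₁) ≤ 0.5571 ∧
    (2 * (101 / 100) - 1) * (2 * π / 3 - θ₁) + 51 / 50 * 2 * (r3 / 2 - s₁) ≤ 0.2509 ∧
    (2 * (1 - 101 / 100) * 5.7275 + (2 * (101 / 100) - 1) * (-0.5107)) * (2 * π / 3 - θ₁) +
      51 / 50 * (-2 * 5.7275 + 2 * (-0.5107)) * (r3 / 2 - s₁) ≤ 1.3779 ∧
    (3 / 2 - 55 / 82 * (101 / 100)) * (θ₀ - 2 * π / 3) + 51 / 50 * (-(55 / 82)) * (s₀ - r3 / 2) ≤ 1.2432 ∧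
    (1 - 2 * (101 / 100)) * (θ₀ - 2 * π / 3) + 51 / 50 * (-2) * (s₀ - r3 / 2) ≤ 0.5568 ∧
    (0.5002 - (1 / 2 - 101 / 100) * 1.8378 + 2 * (101 / 100) * 5.7275 + (1 - 2 * (101 / 100)) * (-0.5107)) *
        (θ₀ - 2 * π / 3) + 51 / 50 * (1.8378 + 2 * 5.7275 - 2 * (-0.5107)) * (s₀ - r3 / 2) ≤ 1.6677 ∧
    (3 / 2 - 101 / 100) * (π - θ₀) + 51 / 50 * (-1) * (0 - s₀) ≤ 0.2113 ∧
    (1 + 5 * (101 / 100)) * (π - θ₀) + 51 / 50 * 5 * (0 - s₀) ≤ 0.1365 ∧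
    (0.5002 - (1 / 2 - 101 / 100) * 1.8378 + 5 * (1 / 5 + 101 / 100) * (-0.5107) + 5 * (-(101 / 100)) * 1.7918) *
        (π - θ₀) + 51 / 50 * (1.8378 + 5 * (-0.5107) - 5 * 1.7918) * (0 - s₀) ≤ -0.1196 := by
  have hπb := pi_div_two_bounds
  refine ⟨?_, ?_, ?_, ?_, ?_, ?_, ?_, ?_, ?_, ?_, ?_, ?_⟩ <;> linarith

set_option maxHeartbeats 1600000 in
/-- **The integral of the majorant over `[0, π]`.** With `σ(θ) = 1.01 + 1.02 cos θ` and
`g(θ) = α(σ) L + β(σ) log L + γ(σ)`: `g` is integrable on `[0, π]` and for `L ≥ 24`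
`∫₀^π g ≤ 3.5923 L + 1.043 log L + 4.712` (eight arcs: four monotone cells of `R1`, then
`R2, R3, R4a, R4b`, each affine in `cos θ`, with the enclosures of `θ₁, θ₀` above). [folklore] -/
theorem integral_majorant_le
    (hα : αf = fun σ ↦ if σ < 0 then 3 / 2 - σ else if σ < 1 / 2 then 3 / 2 - σ + 27 / 82 * σ
      else if σ ≤ 1 then 27 / 82 * (1 - σ) + 1 else 1)
    (hβ : βf = fun σ ↦ if σ < 0 then 1 + 5 * σ else if σ < 1 / 2 then 1 - 2 * σ
      else if σ ≤ 1 then 2 * σ - 1 else if σ ≤ 6 / 5 then 6 - 5 * σ else 0)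
    (hγ : γf = fun σ ↦ if σ < 0 then 0.5002 - (1 / 2 - σ) * 1.8378 + 5 * (1 / 5 + σ) * (-0.5107)
        + 5 * (-σ) * 1.7918
      else if σ < 1 / 2 then 0.5002 - (1 / 2 - σ) * 1.8378 + 2 * σ * 5.7275 + (1 - 2 * σ) * (-0.5107)
      else if σ ≤ 1 then 2 * (1 - σ) * 5.7275 + (2 * σ - 1) * (-0.5107)
      else if σ ≤ 6 / 5 then 5 * (6 / 5 - σ) * (-0.5107) + 5 * (σ - 1) * 1.7918
      else if σ < 5 / 4 then 1.7918 else if σ < 4 / 3 then 1.6095 else if σ < 3 / 2 then 1.3863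
      else 1.0987) {L : ℝ} (hL : 24 ≤ L) :
    (∀ a b : ℝ, IntervalIntegrable (fun θ ↦ αf (101 / 100 + 51 / 50 * Real.cos θ) * L +
      βf (101 / 100 + 51 / 50 * Real.cos θ) * Real.log L + γf (101 / 100 + 51 / 50 * Real.cos θ))
        MeasureTheory.volume a b) ∧
    ∫ θ in (0 : ℝ)..π, (αf (101 / 100 + 51 / 50 * Real.cos θ) * L +
      βf (101 / 100 + 51 / 50 * Real.cos θ) * Real.log L + γf (101 / 100 + 51 / 50 * Real.cos θ)) ≤
        3.5923 * L + 1.043 * Real.log L + 4.712 := by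
  have hπ := Real.pi_pos
  have hπb := pi_div_two_bounds
  have hLL : 0 ≤ Real.log L := Real.log_nonneg (by linarith)
  have hL0 : 0 ≤ L := by linarith
  set g : ℝ → ℝ := fun θ ↦ αf (101 / 100 + 51 / 50 * Real.cos θ) * L +
      βf (101 / 100 + 51 / 50 * Real.cos θ) * Real.log L + γf (101 / 100 + 51 / 50 * Real.cos θ) with hg
  -- integrability on any interval: measurable and bounded
  obtain ⟨mα, mβ, mγ⟩ := measurable_abg hα hβ hγ
  have hσm : Measurable fun θ : ℝ ↦ 101 / 100 + 51 / 50 * Real.cos θ :=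
    measurable_const.add (measurable_const.mul Real.measurable_cos)
  have hgm : Measurable g :=
    (((mα.comp hσm).mul_const L).add ((mβ.comp hσm).mul_const _)).add (mγ.comp hσm)
  have hgb : ∀ θ, ‖g θ‖ ≤ 2 * L + Real.log L + 15 := by
    intro θ
    obtain ⟨m1, m2⟩ := sigma_mem θ
    obtain ⟨⟨a0, a2⟩, ⟨b0, b1⟩, c15⟩ := abg_bounds hα hβ hγ m1 m2
    rw [abs_le] at c15
    rw [Real.norm_eq_abs, abs_le]
    constructor <;> nlinarith
  have hint : ∀ a b : ℝ, IntervalIntegrable g MeasureTheory.volume a b := by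
    intro a b
    refine (intervalIntegrable_const (c := 2 * L + Real.log L + 15)).mono_fun'
      hgm.aestronglyMeasurable (Filter.Eventually.of_forall fun θ ↦ hgb θ)
  -- the arc data
  have hord := angles_ordered
  have h1b := theta_one_bounds
  have h0b := theta_zero_bounds
  obtain ⟨-, s1lo, s1hi⟩ := sin_cos_theta_one
  obtain ⟨-, s0lo, s0hi⟩ := sin_cos_theta_zero
  obtain ⟨-, -, sslo, sshi⟩ := cos_sin_node_1384
  have hs3 := ZetaArgBacklund.sqrt_three_bounds
  have hsin23 := ZetaArgBacklund.sin_two_pi_div_three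
  set θ₁ := Real.arccos (-1 / 102) with hθ₁
  set θ₀ := Real.arccos (-101 / 102) with hθ₀
  -- `g` on the eight arcs
  have hA : ∀ x, 0 ≤ x → x ≤ π → αf (101 / 100 + 51 / 50 * Real.cos x) * L +
      βf (101 / 100 + 51 / 50 * Real.cos x) * Real.log L + γf (101 / 100 + 51 / 50 * Real.cos x) = g x :=
    fun x _ _ ↦ rfl
  have arc1 : ∀ x ∈ Ioo (0 : ℝ) 1.05, g x ≤ (L + 1.0987) + 0 * Real.cos x := by
    intro x hx
    obtain ⟨a1, -, -, -⟩ := alpha_arcs hα (x := x) hx.1.le (by linarith [hx.2])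
    obtain ⟨b1, -⟩ := beta_arcs hβ (x := x) hx.1.le (by linarith [hx.2])
    obtain ⟨c1, -⟩ := gamma_arcs hγ (x := x) hx.1.le (by linarith [hx.2])
    rw [hg]; dsimp only
    rw [a1 (by linarith [hx.2]), b1 (by linarith [hx.2]), c1 hx.2.le]; linarith
  have arc2 : ∀ x ∈ Ioo (1.05 : ℝ) 1.24, g x ≤ (L + 1.3863) + 0 * Real.cos x := by
    intro x hx
    obtain ⟨a1, -, -, -⟩ := alpha_arcs hα (x := x) (by linarith [hx.1]) (by linarith [hx.2])
    obtain ⟨b1, -⟩ := beta_arcs hβ (x := x) (by linarith [hx.1]) (by linarith [hx.2])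
    obtain ⟨-, c2, -⟩ := gamma_arcs hγ (x := x) (by linarith [hx.1]) (by linarith [hx.2])
    rw [hg]; dsimp only
    rw [a1 (by linarith [hx.2]), b1 (by linarith [hx.2])]; linarith [c2 hx.2.le]
  have arc3 : ∀ x ∈ Ioo (1.24 : ℝ) 1.33, g x ≤ (L + 1.6095) + 0 * Real.cos x := by
    intro x hx
    obtain ⟨a1, -, -, -⟩ := alpha_arcs hα (x := x) (by linarith [hx.1]) (by linarith [hx.2])
    obtain ⟨b1, -⟩ := beta_arcs hβ (x := x) (by linarith [hx.1]) (by linarith [hx.2])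
    obtain ⟨-, -, c3, -⟩ := gamma_arcs hγ (x := x) (by linarith [hx.1]) (by linarith [hx.2])
    rw [hg]; dsimp only
    rw [a1 (by linarith [hx.2]), b1 (by linarith [hx.2])]; linarith [c3 hx.2.le]
  have arc4 : ∀ x ∈ Ioo (1.33 : ℝ) 1.384, g x ≤ (L + 0.005 * Real.log L + 1.7918) + 0 * Real.cos x := by
    intro x hx
    obtain ⟨a1, -, -, -⟩ := alpha_arcs hα (x := x) (by linarith [hx.1]) (by linarith [hx.2])
    obtain ⟨-, b2, -⟩ := beta_arcs hβ (x := x) (by linarith [hx.1]) (by linarith [hx.2])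
    obtain ⟨-, -, -, c4, -⟩ := gamma_arcs hγ (x := x) (by linarith [hx.1]) (by linarith [hx.2])
    obtain ⟨b0, b5⟩ := b2 hx.2.le
    rw [hg]; dsimp only
    rw [a1 (by linarith [hx.2])]
    have := mul_le_mul_of_nonneg_right b5 hLL
    linarith [c4 hx.2.le]
  have arc5 : ∀ x ∈ Ioo (1.384 : ℝ) θ₁, g x =
      (L + (6 - 5 * (101 / 100)) * Real.log L + (5 * (6 / 5 - 101 / 100) * (-0.5107) + 5 * (101 / 100 - 1) * 1.7918)) +
      (51 / 50 * (-5 * Real.log L + (5 * 0.5107 + 5 * 1.7918))) * Real.cos x := by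
    intro x hx
    have hxπ : x ≤ π := by linarith [hx.2]
    obtain ⟨a1, -, -, -⟩ := alpha_arcs hα (x := x) (by linarith [hx.1]) hxπ
    obtain ⟨-, -, b3, -⟩ := beta_arcs hβ (x := x) (by linarith [hx.1]) hxπ
    obtain ⟨-, -, -, -, c5, -⟩ := gamma_arcs hγ (x := x) (by linarith [hx.1]) hxπ
    rw [hg]; dsimp only
    rw [a1 hx.2, b3 hx.1.le hx.2, c5 hx.1.le hx.2]; ring
  have arc6 : ∀ x ∈ Ioo θ₁ (2 * π / 3), g x =
      ((27 / 82 * (1 - 101 / 100) + 1) * L + (2 * (101 / 100) - 1) * Real.log L +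
        (2 * (1 - 101 / 100) * 5.7275 + (2 * (101 / 100) - 1) * (-0.5107))) +
      (51 / 50 * (-(27 / 82) * L + 2 * Real.log L + (-2 * 5.7275 + 2 * (-0.5107)))) * Real.cos x := by
    intro x hx
    have hx0 : 0 ≤ x := by linarith [hx.1]
    have hxπ : x ≤ π := by linarith [hx.2]
    obtain ⟨-, a2, -, -⟩ := alpha_arcs hα (x := x) hx0 hxπ
    obtain ⟨-, -, -, b4, -⟩ := beta_arcs hβ (x := x) hx0 hxπ
    obtain ⟨-, -, -, -, -, c6, -⟩ := gamma_arcs hγ (x := x) hx0 hxπ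
    rw [hg]; dsimp only
    rw [a2 hx.1 hx.2, b4 hx.1 hx.2, c6 hx.1 hx.2]; ring
  have arc7 : ∀ x ∈ Ioo (2 * π / 3) θ₀, g x =
      ((3 / 2 - 55 / 82 * (101 / 100)) * L + (1 - 2 * (101 / 100)) * Real.log L +
        (0.5002 - (1 / 2 - 101 / 100) * 1.8378 + 2 * (101 / 100) * 5.7275 + (1 - 2 * (101 / 100)) * (-0.5107))) +
      (51 / 50 * (-(55 / 82) * L - 2 * Real.log L + (1.8378 + 2 * 5.7275 - 2 * (-0.5107)))) * Real.cos x := by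
    intro x hx
    have hx0 : 0 ≤ x := by linarith [hx.1]
    have hxπ : x ≤ π := by linarith [hx.2]
    obtain ⟨-, -, a3, -⟩ := alpha_arcs hα (x := x) hx0 hxπ
    obtain ⟨-, -, -, -, b5, -⟩ := beta_arcs hβ (x := x) hx0 hxπ
    obtain ⟨-, -, -, -, -, -, c7, -⟩ := gamma_arcs hγ (x := x) hx0 hxπ
    rw [hg]; dsimp only
    rw [a3 hx.1 hx.2, b5 hx.1 hx.2, c7 hx.1 hx.2]; ring
  have arc8 : ∀ x ∈ Ioo θ₀ π, g x =
      ((3 / 2 - 101 / 100) * L + (1 + 5 * (101 / 100)) * Real.log L +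
        (0.5002 - (1 / 2 - 101 / 100) * 1.8378 + 5 * (1 / 5 + 101 / 100) * (-0.5107) + 5 * (-(101 / 100)) * 1.7918)) +
      (51 / 50 * (-L + 5 * Real.log L + (1.8378 + 5 * (-0.5107) - 5 * 1.7918))) * Real.cos x := by
    intro x hx
    have hx0 : 0 ≤ x := by linarith [hx.1]
    obtain ⟨-, -, -, a4⟩ := alpha_arcs hα (x := x) hx0 hx.2.le
    obtain ⟨-, -, -, -, -, b6⟩ := beta_arcs hβ (x := x) hx0 hx.2.le
    obtain ⟨-, -, -, -, -, -, -, c8⟩ := gamma_arcs hγ (x := x) hx0 hx.2.le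
    rw [hg]; dsimp only
    rw [a4 hx.1, b6 hx.1, c8 hx.1]; ring
  -- the eight integrals
  have I1 := ZetaArgBacklund.integral_le_affine_cos (by norm_num) (hint 0 1.05) arc1
  have I2 := ZetaArgBacklund.integral_le_affine_cos (by norm_num) (hint 1.05 1.24) arc2
  have I3 := ZetaArgBacklund.integral_le_affine_cos (by norm_num) (hint 1.24 1.33) arc3
  have I4 := ZetaArgBacklund.integral_le_affine_cos (by norm_num) (hint 1.33 1.384) arc4
  have I5 := ZetaArgBacklund.integral_le_affine_cos hord.1.le (hint 1.384 θ₁) (fun x hx ↦ (arc5 x hx).le)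
  have I6 := ZetaArgBacklund.integral_le_affine_cos hord.2.1.le (hint θ₁ (2 * π / 3))
    (fun x hx ↦ (arc6 x hx).le)
  have I7 := ZetaArgBacklund.integral_le_affine_cos hord.2.2.1.le (hint (2 * π / 3) θ₀)
    (fun x hx ↦ (arc7 x hx).le)
  have I8 := ZetaArgBacklund.integral_le_affine_cos hord.2.2.2.le (hint θ₀ π) (fun x hx ↦ (arc8 x hx).le)
  -- adding up
  have S2 := intervalIntegral.integral_add_adjacent_intervals (hint 0 1.05) (hint 1.05 1.24)
  have S3 := intervalIntegral.integral_add_adjacent_intervals (hint 0 1.24) (hint 1.24 1.33)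
  have S4 := intervalIntegral.integral_add_adjacent_intervals (hint 0 1.33) (hint 1.33 1.384)
  have S5 := intervalIntegral.integral_add_adjacent_intervals (hint 0 1.384) (hint 1.384 θ₁)
  have S6 := intervalIntegral.integral_add_adjacent_intervals (hint 0 θ₁) (hint θ₁ (2 * π / 3))
  have S7 := intervalIntegral.integral_add_adjacent_intervals (hint 0 (2 * π / 3)) (hint (2 * π / 3) θ₀)
  have S8 := intervalIntegral.integral_add_adjacent_intervals (hint 0 θ₀) (hint θ₀ π)
  refine ⟨hint, ?_⟩
  rw [Real.sin_zero, Real.sin_pi, hsin23] at *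
  -- per-arc numerical bounds (linear in the enclosed quantities)
  obtain ⟨n5a, n5b, n5c, n6a, n6b, n6c, n7a, n7b, n7c, n8a, n8b, n8c⟩ :=
    arc_numerics (θ₁ := θ₁) (θ₀ := θ₀) (s₁ := Real.sin θ₁) (s₀ := Real.sin θ₀) (ss := Real.sin 1.384)
      (r3 := Real.sqrt 3) h1b.1 h1b.2 h0b.1 h0b.2 s1lo s1hi s0lo s0hi sslo sshi hs3.1 hs3.2
  -- combine: each arc bound is `L·a + log L·b + c`
  have J5 : ∫ x in (1.384 : ℝ)..θ₁, g x ≤ L * 0.1967 + Real.log L * 0.0984 + 0.1266 := by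
    refine I5.trans ?_
    have e : (L + (6 - 5 * (101 / 100)) * Real.log L + (5 * (6 / 5 - 101 / 100) * (-0.5107) + 5 * (101 / 100 - 1) * 1.7918)) *
        (θ₁ - 1.384) + 51 / 50 * (-5 * Real.log L + (5 * 0.5107 + 5 * 1.7918)) * (Real.sin θ₁ - Real.sin 1.384) =
        L * (1 * (θ₁ - 1.384)) +
        Real.log L * ((6 - 5 * (101 / 100)) * (θ₁ - 1.384) + 51 / 50 * (-5) * (Real.sin θ₁ - Real.sin 1.384)) +
        ((5 * (6 / 5 - 101 / 100) * (-0.5107) + 5 * (101 / 100 - 1) * 1.7918) * (θ₁ - 1.384) +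
          51 / 50 * (5 * 0.5107 + 5 * 1.7918) * (Real.sin θ₁ - Real.sin 1.384)) := by ring
    rw [e]
    linarith only [mul_le_mul_of_nonneg_left n5a hL0, mul_le_mul_of_nonneg_left n5b hLL, n5c]
  have J6 : ∫ x in θ₁..(2 * π / 3), g x ≤ L * 0.5571 + Real.log L * 0.2509 + 1.3779 := by
    refine I6.trans ?_
    have e : ((27 / 82 * (1 - 101 / 100) + 1) * L + (2 * (101 / 100) - 1) * Real.log L +
        (2 * (1 - 101 / 100) * 5.7275 + (2 * (101 / 100) - 1) * (-0.5107))) * (2 * π / 3 - θ₁) +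
        51 / 50 * (-(27 / 82) * L + 2 * Real.log L + (-2 * 5.7275 + 2 * (-0.5107))) * (Real.sqrt 3 / 2 - Real.sin θ₁) =
        L * ((27 / 82 * (1 - 101 / 100) + 1) * (2 * π / 3 - θ₁) + 51 / 50 * (-(27 / 82)) * (Real.sqrt 3 / 2 - Real.sin θ₁)) +
        Real.log L * ((2 * (101 / 100) - 1) * (2 * π / 3 - θ₁) + 51 / 50 * 2 * (Real.sqrt 3 / 2 - Real.sin θ₁)) +
        ((2 * (1 - 101 / 100) * 5.7275 + (2 * (101 / 100) - 1) * (-0.5107)) * (2 * π / 3 - θ₁) +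
          51 / 50 * (-2 * 5.7275 + 2 * (-0.5107)) * (Real.sqrt 3 / 2 - Real.sin θ₁)) := by ring
    rw [e]
    linarith only [mul_le_mul_of_nonneg_left n6a hL0, mul_le_mul_of_nonneg_left n6b hLL, n6c]
  have J7 : ∫ x in (2 * π / 3)..θ₀, g x ≤ L * 1.2432 + Real.log L * 0.5568 + 1.6677 := by
    refine I7.trans ?_
    have e : ((3 / 2 - 55 / 82 * (101 / 100)) * L + (1 - 2 * (101 / 100)) * Real.log L +
        (0.5002 - (1 / 2 - 101 / 100) * 1.8378 + 2 * (101 / 100) * 5.7275 + (1 - 2 * (101 / 100)) * (-0.5107))) *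
          (θ₀ - 2 * π / 3) +
        51 / 50 * (-(55 / 82) * L - 2 * Real.log L + (1.8378 + 2 * 5.7275 - 2 * (-0.5107))) * (Real.sin θ₀ - Real.sqrt 3 / 2) =
        L * ((3 / 2 - 55 / 82 * (101 / 100)) * (θ₀ - 2 * π / 3) + 51 / 50 * (-(55 / 82)) * (Real.sin θ₀ - Real.sqrt 3 / 2)) +
        Real.log L * ((1 - 2 * (101 / 100)) * (θ₀ - 2 * π / 3) + 51 / 50 * (-2) * (Real.sin θ₀ - Real.sqrt 3 / 2)) +
        ((0.5002 - (1 / 2 - 101 / 100) * 1.8378 + 2 * (101 / 100) * 5.7275 + (1 - 2 * (101 / 100)) * (-0.5107)) *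
            (θ₀ - 2 * π / 3) +
          51 / 50 * (1.8378 + 2 * 5.7275 - 2 * (-0.5107)) * (Real.sin θ₀ - Real.sqrt 3 / 2)) := by ring
    rw [e]
    linarith only [mul_le_mul_of_nonneg_left n7a hL0, mul_le_mul_of_nonneg_left n7b hLL, n7c]
  have J8 : ∫ x in θ₀..π, g x ≤ L * 0.2113 + Real.log L * 0.1365 + (-0.1196) := by
    refine I8.trans ?_
    have e : ((3 / 2 - 101 / 100) * L + (1 + 5 * (101 / 100)) * Real.log L +
        (0.5002 - (1 / 2 - 101 / 100) * 1.8378 + 5 * (1 / 5 + 101 / 100) * (-0.5107) + 5 * (-(101 / 100)) * 1.7918)) *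
          (π - θ₀) +
        51 / 50 * (-L + 5 * Real.log L + (1.8378 + 5 * (-0.5107) - 5 * 1.7918)) * (0 - Real.sin θ₀) =
        L * ((3 / 2 - 101 / 100) * (π - θ₀) + 51 / 50 * (-1) * (0 - Real.sin θ₀)) +
        Real.log L * ((1 + 5 * (101 / 100)) * (π - θ₀) + 51 / 50 * 5 * (0 - Real.sin θ₀)) +
        ((0.5002 - (1 / 2 - 101 / 100) * 1.8378 + 5 * (1 / 5 + 101 / 100) * (-0.5107) + 5 * (-(101 / 100)) * 1.7918) *
            (π - θ₀) + 51 / 50 * (1.8378 + 5 * (-0.5107) - 5 * 1.7918) * (0 - Real.sin θ₀)) := by ring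
    rw [e]
    linarith only [mul_le_mul_of_nonneg_left n8a hL0, mul_le_mul_of_nonneg_left n8b hLL, n8c]
  -- the four `R1` cells
  have J1 : ∫ x in (0 : ℝ)..1.05, g x ≤ L * 1.05 + 1.0987 * 1.05 := I1.trans (le_of_eq (by ring))
  have J2 : ∫ x in (1.05 : ℝ)..1.24, g x ≤ L * 0.19 + 1.3863 * 0.19 := I2.trans (le_of_eq (by ring))
  have J3 : ∫ x in (1.24 : ℝ)..1.33, g x ≤ L * 0.09 + 1.6095 * 0.09 := I3.trans (le_of_eq (by ring))
  have J4 : ∫ x in (1.33 : ℝ)..1.384, g x ≤ L * 0.054 + Real.log L * (0.005 * 0.054) + 1.7918 * 0.054 :=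
    I4.trans (le_of_eq (by ring))
  rw [← S8, ← S7, ← S6, ← S5, ← S4, ← S3, ← S2]
  linarith only [J1, J2, J3, J4, J5, J6, J7, J8, hL0, hLL]

end integral


/-! ### Numerics for the assembly -/

/-- `exp 24 ≤ 3.06·10¹⁰`, `log(253/53) ≤ 1.5632`, `log 101 ≤ 4.6155`. [folklore] -/
lemma assembly_numerics :
    Real.exp 24 ≤ 30610046000 ∧ Real.log (253 / 53) ≤ 1.5632 ∧ Real.log 101 ≤ 4.6155 := by
  have he := Real.exp_one_lt_d9
  have he' := Real.exp_one_gt_d9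
  refine ⟨?_, ?_, ?_⟩
  · have : Real.exp 24 = Real.exp 1 ^ 24 := by rw [← Real.exp_nat_mul]; norm_num
    rw [this]
    calc Real.exp 1 ^ 24 ≤ 2.7182818286 ^ 24 := by gcongr
      _ ≤ 30610046000 := by norm_num
  · rw [Real.log_le_iff_le_exp (by norm_num)]
    have h1 : Real.exp 1.5632 = Real.exp 1 * Real.exp 0.5632 := by rw [← Real.exp_add]; norm_num
    have h2 : (1.7562 : ℝ) ≤ Real.exp 0.5632 := by
      refine le_trans ?_ (Real.sum_le_exp_of_nonneg (by norm_num) 7)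
      norm_num [Finset.sum_range_succ, Nat.factorial]
    rw [h1]; nlinarith [Real.exp_pos 0.5632]
  · rw [Real.log_le_iff_le_exp (by norm_num)]
    have h1 : Real.exp 4.6155 = Real.exp 1 ^ 4 * Real.exp 0.6155 := by
      rw [← Real.exp_nat_mul, ← Real.exp_add]; norm_num
    have h2 : (1.8505 : ℝ) ≤ Real.exp 0.6155 := by
      refine le_trans ?_ (Real.sum_le_exp_of_nonneg (by norm_num) 7)
      norm_num [Finset.sum_range_succ, Nat.factorial]
    have h4 : (2.7182818283 : ℝ) ^ 4 ≤ Real.exp 1 ^ 4 := by gcongr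
    rw [h1]; nlinarith [Real.exp_pos 0.6155]

/-- **The final numerical inequality.** [folklore] -/
lemma final_numeric_hsw {ℓ Lx T : ℝ} (hℓ : 24 ≤ ℓ) (hLx1 : ℓ ≤ Lx) (hLx2 : Lx ≤ ℓ + 0.0044)
    (hT : 30610046000 ≤ T) :
    1.5632 / π + (π⁻¹ * (3.5923 * Lx + 1.043 * Real.log Lx + 4.712) - ℓ + 4.6155) / (2 * Real.log 2) +
      1.3 / (π * T) ≤ 0.1035 * ℓ + 0.2395 * Real.log ℓ + 4.92 := by
  have hπl := Real.pi_gt_d20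
  have hπu := Real.pi_lt_d20
  have hπ := Real.pi_pos
  have hl2 := Real.log_two_gt_d9
  have hℓ0 : 0 < ℓ := by linarith
  have hlogℓ : 0 ≤ Real.log ℓ := Real.log_nonneg (by linarith)
  -- `log Lx ≤ log ℓ + 0.0002`
  have hlx : Real.log Lx ≤ Real.log ℓ + 0.0002 := by
    have h1 : Real.log Lx - Real.log ℓ = Real.log (Lx / ℓ) := (Real.log_div (by linarith) hℓ0.ne').symm
    have h2 : Real.log (Lx / ℓ) ≤ Lx / ℓ - 1 := Real.log_le_sub_one_of_pos (div_pos (by linarith) hℓ0)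
    have h3 : Lx / ℓ - 1 ≤ 0.0044 / 24 := by
      rw [div_sub_one hℓ0.ne', div_le_div_iff₀ hℓ0 (by norm_num)]; nlinarith
    linarith
  have hinv : π⁻¹ ≤ 0.3183099 := by
    rw [inv_le_comm₀ hπ (by norm_num)]; linarith
  have hinv0 : 0 ≤ π⁻¹ := by positivity
  have hlogLx : 0 ≤ Real.log Lx := Real.log_nonneg (by linarith)
  have hX0 : 0 ≤ 3.5923 * Lx + 1.043 * Real.log Lx + 4.712 := by linarith
  have hA : π⁻¹ * (3.5923 * Lx + 1.043 * Real.log Lx + 4.712) ≤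
      0.3183099 * (3.5923 * (ℓ + 0.0044) + 1.043 * (Real.log ℓ + 0.0002) + 4.712) := by
    calc π⁻¹ * (3.5923 * Lx + 1.043 * Real.log Lx + 4.712)
        ≤ 0.3183099 * (3.5923 * Lx + 1.043 * Real.log Lx + 4.712) := mul_le_mul_of_nonneg_right hinv hX0
      _ ≤ _ := by nlinarith
  set N := π⁻¹ * (3.5923 * Lx + 1.043 * Real.log Lx + 4.712) - ℓ + 4.6155 with hN
  have hN0 : 0 ≤ N := by
    have : ℓ ≤ π⁻¹ * (3.5923 * Lx) := by
      rw [← div_eq_inv_mul, le_div_iff₀ hπ]; nlinarith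
    have : 0 ≤ π⁻¹ * (1.043 * Real.log Lx + 4.712) := mul_nonneg hinv0 (by linarith)
    nlinarith
  have hq : 1 / (2 * Real.log 2) ≤ 0.7213476 := by
    rw [div_le_iff₀ (by positivity)]; nlinarith
  have hNq : N / (2 * Real.log 2) ≤ 0.7213476 * N := by
    rw [div_eq_mul_one_div, mul_comm]
    exact mul_le_mul_of_nonneg_right hq hN0
  have h1 : 1.5632 / π ≤ 1.5632 * 0.3183099 := by
    rw [div_eq_mul_inv]; exact mul_le_mul_of_nonneg_left hinv (by norm_num)
  have h3 : 1.3 / (π * T) ≤ 0.0001 := by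
    rw [div_le_iff₀ (by positivity)]
    have : (3 : ℝ) * 30610046000 ≤ π * T := mul_le_mul (by linarith) hT (by norm_num) hπ.le
    linarith
  have hNle : N ≤ 0.3183099 * (3.5923 * (ℓ + 0.0044) + 1.043 * (Real.log ℓ + 0.0002) + 4.712) - ℓ + 4.6155 := by
    rw [hN]; linarith
  nlinarith [mul_le_mul_of_nonneg_left hNle (by norm_num : (0:ℝ) ≤ 0.7213476)]

/-! ### The main estimate at a height that is not an ordinate -/

/-- `log |2²⁷ + w| ≤ log (T + 134217734)` for `|Re w| ≤ 3`, `|Im w| ≤ T + 3`. [folklore] -/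
lemma log_norm_shift_le {w : ℂ} {T : ℝ} (hre : |w.re| ≤ 3) (him : |w.im| ≤ T + 3) :
    Real.log ‖(134217728 : ℂ) + w‖ ≤ Real.log (T + 134217734) := by
  have h1 : ‖(134217728 : ℂ) + w‖ ≤ T + 134217734 := by
    refine (norm_le_abs_re_add_abs_im _).trans ?_
    simp only [add_re, add_im]
    rw [show ((134217728 : ℂ)).re = 134217728 by norm_num, show ((134217728 : ℂ)).im = 0 by norm_num,
      zero_add]
    have : |(134217728 : ℝ) + w.re| ≤ 134217728 + 3 := by
      rw [abs_le] at hre ⊢; constructor <;> linarith [hre.1, hre.2]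
    linarith
  have h0 : 0 < ‖(134217728 : ℂ) + w‖ := by
    have h2 : (134217725 : ℝ) ≤ ((134217728 : ℂ) + w).re := by
      simp only [add_re]; rw [show ((134217728 : ℂ)).re = 134217728 by norm_num]
      rw [abs_le] at hre; linarith [hre.1]
    exact lt_of_lt_of_le (by norm_num) (h2.trans (re_le_norm _))
  exact Real.log_le_log h0 h1


/-- An algebraic identity used to divide the assembled bound by `π`. [folklore] -/
lemma div_pi_identity (a N l2 T p : ℝ) (hp : p ≠ 0) (hT : T ≠ 0) (hl : l2 ≠ 0) :
    (a + (p * N / (2 * l2) + 1 / T / 2 + 0.765 / T)) / p = a / p + N / (2 * l2) + 1.265 / (p * T) := by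
  field_simp
  ring

set_option maxHeartbeats 1600000 in
/-- **The explicit bound for `S(T)` off the ordinates.** For `T ≥ 30 610 046 000` that is not the
ordinate of a zero of `ζ`, `|S(T)| ≤ 0.1035 log T + 0.2395 log log T + 4.92`.
Proof ([HSW22, §§2–5] with the parameters `c = 1.01`, `r = 1.02`, `σ₁ = 1.265`):
`π|S(T)| ≤ log ζ(σ₁) + |Im ∫_{1/2}^{σ₁} ζ'/ζ|` (`ZetaArgPrimeZetaLog.pi_mul_abs_zetaArgS_le`);
`ζ'/ζ = ζ₁'/ζ₁ − 1/(s−1)` with `|Im ∫ 1/(s−1)| ≤ 0.765/T`; Backlund's trick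
(`Literature.Analysis.Complex.abs_im_integral_logDeriv_le_backlundTrick`) for `ζ₁` on
`|s − (1.01+iT)| ≤ 1.02` with the reflection error `1/T`
(`ZetaBacklundReflection.abs_im_integral_logDeriv_riemannZeta₁_reflect_le`), the majorant
`exp(α L + β log L + γ)` of this file (`L = log(T + 2²⁷ + 6)`), its integral
(`integral_majorant_le`), and `|ζ₁(1.01+iT)| ≥ T/101` at the centre.
[cite: HasanalizadeShenWong2022, Theorem 1.3] -/
theorem abs_zetaArgS_le_of_not_ordinate_hsw {T : ℝ} (hT : 30610046000 ≤ T)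
    (hT' : ∀ ρ : ℂ, riemannZeta ρ = 0 → ρ.im ≠ T) :
    |zetaArgS T| ≤ 0.1035 * Real.log T + 0.2395 * Real.log (Real.log T) + 4.92 := by
  have hT0 : 0 < T := by linarith
  have hπ := Real.pi_pos
  obtain ⟨hexp24, hlog253, hlog101⟩ := assembly_numerics
  set ℓ := Real.log T with hℓdef
  have hℓ : 24 ≤ ℓ := by
    rw [hℓdef, Real.le_log_iff_exp_le hT0]; exact hexp24.trans hT
  set L := Real.log (T + 134217734) with hLdef
  have hℓL : ℓ ≤ L := Real.log_le_log hT0 (by linarith)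
  have hL24 : 24 ≤ L := hℓ.trans hℓL
  have hLℓ : L ≤ ℓ + 0.0044 := by
    have h1 : L - ℓ = Real.log ((T + 134217734) / T) := (Real.log_div (by linarith) hT0.ne').symm
    have h2 : Real.log ((T + 134217734) / T) ≤ (T + 134217734) / T - 1 :=
      Real.log_le_sub_one_of_pos (by positivity)
    have h3 : (T + 134217734) / T - 1 ≤ 0.0044 := by
      rw [div_sub_one hT0.ne', div_le_iff₀ hT0]; nlinarith
    linarith
  -- the majorant
  obtain ⟨αf, hα⟩ : ∃ αf : ℝ → ℝ, αf = fun σ ↦ if σ < 0 then 3 / 2 - σ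
      else if σ < 1 / 2 then 3 / 2 - σ + 27 / 82 * σ else if σ ≤ 1 then 27 / 82 * (1 - σ) + 1 else 1 :=
    ⟨_, rfl⟩
  obtain ⟨βf, hβ⟩ : ∃ βf : ℝ → ℝ, βf = fun σ ↦ if σ < 0 then 1 + 5 * σ else if σ < 1 / 2 then 1 - 2 * σ
      else if σ ≤ 1 then 2 * σ - 1 else if σ ≤ 6 / 5 then 6 - 5 * σ else 0 := ⟨_, rfl⟩
  obtain ⟨γf, hγ⟩ : ∃ γf : ℝ → ℝ, γf = fun σ ↦ if σ < 0 then 0.5002 - (1 / 2 - σ) * 1.8378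
        + 5 * (1 / 5 + σ) * (-0.5107) + 5 * (-σ) * 1.7918
      else if σ < 1 / 2 then 0.5002 - (1 / 2 - σ) * 1.8378 + 2 * σ * 5.7275 + (1 - 2 * σ) * (-0.5107)
      else if σ ≤ 1 then 2 * (1 - σ) * 5.7275 + (2 * σ - 1) * (-0.5107)
      else if σ ≤ 6 / 5 then 5 * (6 / 5 - σ) * (-0.5107) + 5 * (σ - 1) * 1.7918
      else if σ < 5 / 4 then 1.7918 else if σ < 4 / 3 then 1.6095 else if σ < 3 / 2 then 1.3863
      else 1.0987 := ⟨_, rfl⟩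
  set F : ℝ → ℝ := fun σ ↦ αf σ * L + βf σ * Real.log L + γf σ with hF
  set B : ℂ → ℝ := fun z ↦ Real.exp (F z.re) with hB
  -- geometry of the circle `|z − 1.01| = 1.02`
  have hsphere : ∀ z ∈ Metric.sphere (((101 / 100 : ℝ)) : ℂ) (51 / 50),
      |z.re - 101 / 100| ≤ 51 / 50 ∧ |z.im| ≤ 51 / 50 := by
    intro z hz
    rw [Metric.mem_sphere, dist_eq_norm] at hz
    have h1 := abs_re_le_norm (z - ((101 / 100 : ℝ) : ℂ))
    have h2 := abs_im_le_norm (z - ((101 / 100 : ℝ) : ℂ))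
    simp only [sub_re, sub_im, ofReal_re, ofReal_im, sub_zero] at h1 h2
    rw [hz] at h1 h2
    exact ⟨h1, h2⟩
  have hmaj : ∀ w : ℂ, |w.re - 101 / 100| ≤ 51 / 50 → |w.im - T| ≤ 51 / 50 →
      ‖riemannZeta₁ w‖ ≤ B w := by
    intro w hre him
    rw [abs_le] at hre him
    have hN : Real.log ‖(134217728 : ℂ) + w‖ ≤ L :=
      log_norm_shift_le (by rw [abs_le]; constructor <;> linarith)
        (by rw [abs_le]; constructor <;> linarith)
    have hN' : Real.log ‖(134217728 : ℂ) + (1 - conj w)‖ ≤ L :=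
      log_norm_shift_le (by simp only [sub_re, one_re, conj_re]; rw [abs_le]; constructor <;> linarith)
        (by simp only [sub_im, one_im, conj_im, zero_sub, neg_neg]; rw [abs_le]; constructor <;> linarith)
    have h := norm_riemannZeta₁_le_exp_abg hα hβ hγ hL24 (by linarith) (by linarith) hN hN'
    simpa [hB, hF] using h
  have hBound : ∀ z ∈ Metric.sphere (((101 / 100 : ℝ)) : ℂ) (51 / 50),
      ‖riemannZeta₁ (z + T * I)‖ ≤ B z ∧ ‖riemannZeta₁ (conj z + T * I)‖ ≤ B z := by
    intro z hz
    obtain ⟨h1, h2⟩ := hsphere z hz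
    rw [abs_le] at h2
    constructor
    · have := hmaj (z + T * I) (by simpa using h1) (by simp; rw [abs_le]; constructor <;> linarith)
      simpa [hB] using this
    · have := hmaj (conj z + T * I) (by simpa using h1) (by simp; rw [abs_le]; constructor <;> linarith)
      simpa [hB] using this
  have hB1 : ∀ z ∈ Metric.sphere (((101 / 100 : ℝ)) : ℂ) (51 / 50), 1 ≤ B z := by
    intro z hz
    obtain ⟨h1, -⟩ := hsphere z hz
    rw [abs_le] at h1
    obtain ⟨⟨a1, -⟩, ⟨b0, -⟩, c15⟩ := abg_bounds hα hβ hγ (σ := z.re) (by linarith) (by linarith)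
    rw [abs_le] at c15
    have hLL : 0 ≤ Real.log L := Real.log_nonneg (by linarith)
    refine Real.one_le_exp ?_
    show 0 ≤ αf z.re * L + βf z.re * Real.log L + γf z.re
    nlinarith
  -- integrability and the circle average
  obtain ⟨hint, hIle⟩ := integral_majorant_le hα hβ hγ hL24
  have hlogB : (fun z ↦ Real.log (B z)) = fun z ↦ F z.re := by
    funext z; simp only [hB, Real.log_exp]
  have hBi : CircleIntegrable (fun z ↦ Real.log (B z)) (((101 / 100 : ℝ)) : ℂ) (51 / 50) := by
    rw [hlogB]
    unfold CircleIntegrable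
    simp only [Literature.Analysis.Complex.circleMap_ofReal_re]
    exact hint 0 (2 * π)
  have hA : Real.circleAverage (fun z ↦ Real.log (B z)) (((101 / 100 : ℝ)) : ℂ) (51 / 50) ≤
      π⁻¹ * (3.5923 * L + 1.043 * Real.log L + 4.712) := by
    rw [hlogB, ZetaArgBacklund.circleAverage_re_eq' (b := F) (c := 101 / 100) (R := 51 / 50) (hint 0 π)]
    exact mul_le_mul_of_nonneg_left hIle (inv_nonneg.2 hπ.le)
  -- Backlund's trick for `ζ₁`
  have hg_an : ∀ z ∈ Metric.closedBall ((((101 / 100 : ℝ)) : ℂ) + T * I) (51 / 50),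
      AnalyticAt ℂ riemannZeta₁ z := fun z _ ↦ differentiable_riemannZeta₁.analyticAt z
  have hζ₁T : ∀ x : ℝ, riemannZeta₁ ((x : ℂ) + T * I) ≠ 0 :=
    ZetaBacklundReflection.riemannZeta₁_ne_zero_of_im_eq hT0 hT'
  have hc0 : riemannZeta₁ ((((101 / 100 : ℝ)) : ℂ) + T * I) ≠ 0 := hζ₁T _
  have h0 : ∀ x : ℝ, x ∈ Icc ((101 / 100 : ℝ) - 51 / 100 - (51 / 100 - (51 / 100) ^ 2 / (51 / 50)))
      (101 / 100 + (51 / 100) ^ 2 / (51 / 50)) → riemannZeta₁ ((x : ℂ) + T * I) ≠ 0 := fun x _ ↦ hζ₁T x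
  have hT4 : 4 ≤ T := by linarith
  have hrefl : ∀ d ∈ Icc (0 : ℝ) (51 / 100 - (51 / 100) ^ 2 / (51 / 50)),
      |(∫ x in ((101 / 100 : ℝ) - 51 / 100)..((101 / 100 : ℝ) - 51 / 100 + d),
          deriv riemannZeta₁ ((x : ℂ) + T * I) / riemannZeta₁ ((x : ℂ) + T * I)).im +
        (∫ x in ((101 / 100 : ℝ) - 51 / 100)..((101 / 100 : ℝ) - 51 / 100 - d),
          deriv riemannZeta₁ ((x : ℂ) + T * I) / riemannZeta₁ ((x : ℂ) + T * I)).im| ≤ 1 / T := by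
    intro d hd
    have hd' : d ≤ 3 / 8 := by have := hd.2; norm_num at this; linarith
    have h := ZetaBacklundReflection.abs_im_integral_logDeriv_riemannZeta₁_reflect_le hT4 hT' hd.1 hd'
    rw [show (101 / 100 : ℝ) - 51 / 100 = 1 / 2 by norm_num]
    exact h
  have hH := Literature.Analysis.Complex.abs_im_integral_logDeriv_le_backlundTrick
    (g := riemannZeta₁) (B := B) (c := 101 / 100) (y := T) (ρ := 51 / 100) (R := 51 / 50)
    (A := π⁻¹ * (3.5923 * L + 1.043 * Real.log L + 4.712)) (ε := 1 / T)
    (by norm_num) (by norm_num) hg_an hc0 hBound hB1 hBi hA h0 (by positivity) hrefl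
  rw [show (101 / 100 : ℝ) - 51 / 100 = 1 / 2 by norm_num,
    show (101 / 100 : ℝ) + (51 / 100) ^ 2 / (51 / 50) = 253 / 200 by norm_num,
    show (51 / 50 : ℝ) / (51 / 100) = 2 by norm_num] at hH
  -- the centre: `log |ζ₁(1.01 + iT)| ≥ log T − log 101`
  have hcentre : ℓ - Real.log 101 ≤ Real.log ‖riemannZeta₁ ((((101 / 100 : ℝ)) : ℂ) + T * I)‖ := by
    have hs1 : ((((101 / 100 : ℝ)) : ℂ) + T * I) ≠ 1 := fun h ↦ by
      have := congrArg Complex.im h; simp at this; linarith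
    rw [riemannZeta₁_eq_mul hs1, norm_mul]
    have hT1 : T ≤ ‖(((101 / 100 : ℝ)) : ℂ) + T * I - 1‖ := by
      have h := abs_im_le_norm ((((101 / 100 : ℝ)) : ℂ) + T * I - 1)
      rw [show ((((101 / 100 : ℝ)) : ℂ) + T * I - 1).im = T by simp, abs_of_pos hT0] at h
      exact h
    have hlow := Literature.NumberTheory.LFunctions.norm_riemannZeta_ge_div
      (s := (((101 / 100 : ℝ)) : ℂ) + T * I) (by simp; norm_num)
    have hsre : ((((101 / 100 : ℝ)) : ℂ) + T * I).re = 101 / 100 := by simp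
    rw [hsre] at hlow
    have hz2 : 1 ≤ ‖riemannZeta ((2 * (101 / 100) : ℝ) : ℂ)‖ := by
      rw [norm_riemannZeta_ofReal_eq_re (by norm_num)]
      exact one_le_re_riemannZeta_ofReal (by norm_num)
    have hz1 : ‖riemannZeta ((101 / 100 : ℝ) : ℂ)‖ ≤ 101 := by
      rw [norm_riemannZeta_ofReal_eq_re (by norm_num)]
      have h := re_riemannZeta_ofReal_le_sum_add (σ := 101 / 100) (by norm_num) (N := 1) le_rfl
      simp only [Finset.sum_range_one, Nat.cast_zero, zero_add, Real.one_rpow, Nat.cast_one] at h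
      have e : (1 : ℝ) + 1 / (101 / 100 - 1) = 101 := by norm_num
      rw [e] at h; exact h
    have hz1pos : 0 < ‖riemannZeta ((101 / 100 : ℝ) : ℂ)‖ := by
      rw [norm_riemannZeta_ofReal_eq_re (by norm_num)]
      exact lt_of_lt_of_le zero_lt_one (one_le_re_riemannZeta_ofReal (by norm_num))
    have hζlow : 1 / 101 ≤ ‖riemannZeta ((((101 / 100 : ℝ)) : ℂ) + T * I)‖ := by
      refine le_trans ?_ hlow
      rw [div_le_div_iff₀ (by norm_num) hz1pos]; nlinarith
    have hζpos : 0 < ‖riemannZeta ((((101 / 100 : ℝ)) : ℂ) + T * I)‖ := lt_of_lt_of_le (by norm_num) hζlow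
    rw [Real.log_mul (by linarith) hζpos.ne']
    have e1 : Real.log T ≤ Real.log ‖(((101 / 100 : ℝ)) : ℂ) + T * I - 1‖ := Real.log_le_log hT0 hT1
    have e2 : Real.log (1 / 101) ≤ Real.log ‖riemannZeta ((((101 / 100 : ℝ)) : ℂ) + T * I)‖ :=
      Real.log_le_log (by norm_num) hζlow
    rw [Real.log_div (by norm_num) (by norm_num), Real.log_one, zero_sub] at e2
    rw [hℓdef]; linarith
  -- `π |S| ≤ log ζ(σ₁) + |Im ∫ ζ'/ζ|`
  have hS := ZetaArgPrimeZetaLog.pi_mul_abs_zetaArgS_le (σ := 253 / 200) hT0 hT' (by norm_num) (by norm_num)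
  -- `∫ ζ'/ζ = ∫ ζ₁'/ζ₁ − ∫ (s−1)⁻¹`
  have hζT : ∀ x : ℝ, riemannZeta ((x : ℂ) + T * I) ≠ 0 := fun x h ↦ hT' _ h (by simp)
  have hx1 : ∀ x : ℝ, ((x : ℂ) + T * I) ≠ 1 := fun x h ↦ by
    have := congrArg Complex.im h; simp at this; linarith
  have hptw : ∀ x : ℝ, deriv riemannZeta ((x : ℂ) + T * I) / riemannZeta ((x : ℂ) + T * I) =
      deriv riemannZeta₁ ((x : ℂ) + T * I) / riemannZeta₁ ((x : ℂ) + T * I) - ((x : ℂ) + T * I - 1)⁻¹ := by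
    intro x
    rw [← logDeriv_apply, ← logDeriv_apply]
    exact logDeriv_riemannZeta_eq (hx1 x) (hζT x)
  have hf₁c : Continuous fun x : ℝ ↦ deriv riemannZeta₁ ((x : ℂ) + T * I) / riemannZeta₁ ((x : ℂ) + T * I) :=
    ZetaBacklundReflection.continuous_logDeriv_riemannZeta₁_horizontal hT0 hT'
  have hinvc : Continuous fun x : ℝ ↦ ((x : ℂ) + T * I - 1)⁻¹ := by
    refine Continuous.inv₀ (by fun_prop) fun x h ↦ ?_
    exact hx1 x (sub_eq_zero.1 h)
  have hdec : (∫ x in (1 / 2 : ℝ)..(253 / 200),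
      deriv riemannZeta ((x : ℂ) + T * I) / riemannZeta ((x : ℂ) + T * I)) =
      (∫ x in (1 / 2 : ℝ)..(253 / 200),
        deriv riemannZeta₁ ((x : ℂ) + T * I) / riemannZeta₁ ((x : ℂ) + T * I)) -
      ∫ x in (1 / 2 : ℝ)..(253 / 200), ((x : ℂ) + T * I - 1)⁻¹ := by
    rw [← intervalIntegral.integral_sub (hf₁c.intervalIntegrable _ _) (hinvc.intervalIntegrable _ _)]
    exact intervalIntegral.integral_congr fun x _ ↦ hptw x
  have hinv_bound : ‖∫ x in (1 / 2 : ℝ)..(253 / 200), ((x : ℂ) + T * I - 1)⁻¹‖ ≤ 1 / T * |253 / 200 - 1 / 2| := by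
    refine intervalIntegral.norm_integral_le_of_norm_le_const fun x _ ↦ ?_
    rw [norm_inv, one_div]
    apply inv_anti₀ hT0
    have := abs_im_le_norm ((x : ℂ) + T * I - 1); simp at this; rw [abs_of_pos hT0] at this; exact this
  have hIm : |(∫ x in (1 / 2 : ℝ)..(253 / 200),
      deriv riemannZeta ((x : ℂ) + T * I) / riemannZeta ((x : ℂ) + T * I)).im| ≤
      |(∫ x in (1 / 2 : ℝ)..(253 / 200),
        deriv riemannZeta₁ ((x : ℂ) + T * I) / riemannZeta₁ ((x : ℂ) + T * I)).im| + 0.765 / T := by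
    rw [hdec, Complex.sub_im]
    refine (abs_sub _ _).trans (add_le_add le_rfl ?_)
    refine (abs_im_le_norm _).trans (hinv_bound.trans ?_)
    norm_num
    exact le_of_eq (by ring)
  -- assembly
  have hlogζ : Real.log (riemannZeta ((253 / 200 : ℝ) : ℂ)).re ≤ 1.5632 := by
    refine (log_re_riemannZeta_le_crude (by norm_num)).trans ?_
    rw [show (253 / 200 : ℝ) / (253 / 200 - 1) = 253 / 53 by norm_num]; exact hlog253
  have hlog2 : 0 < Real.log 2 := Real.log_pos (by norm_num)
  have hH' : |(∫ x in (1 / 2 : ℝ)..(253 / 200),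
      deriv riemannZeta₁ ((x : ℂ) + T * I) / riemannZeta₁ ((x : ℂ) + T * I)).im| ≤
      π * (π⁻¹ * (3.5923 * L + 1.043 * Real.log L + 4.712) - ℓ + 4.6155) / (2 * Real.log 2) + 1 / T / 2 := by
    refine hH.trans (add_le_add ?_ le_rfl)
    apply div_le_div_of_nonneg_right _ (by positivity)
    apply mul_le_mul_of_nonneg_left _ hπ.le
    linarith
  have key : π * |zetaArgS T| ≤ 1.5632 +
      (π * (π⁻¹ * (3.5923 * L + 1.043 * Real.log L + 4.712) - ℓ + 4.6155) / (2 * Real.log 2) + 1 / T / 2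
        + 0.765 / T) := by
    refine hS.trans (add_le_add hlogζ ?_)
    refine hIm.trans ?_
    linarith
  set N := π⁻¹ * (3.5923 * L + 1.043 * Real.log L + 4.712) - ℓ + 4.6155 with hN
  have key1 : |zetaArgS T| ≤ (1.5632 + (π * N / (2 * Real.log 2) + 1 / T / 2 + 0.765 / T)) / π := by
    rw [le_div_iff₀ hπ, mul_comm]; exact key
  have key2 : |zetaArgS T| ≤ 1.5632 / π + N / (2 * Real.log 2) + 1.3 / (π * T) := by
    have e : (1.5632 + (π * N / (2 * Real.log 2) + 1 / T / 2 + 0.765 / T)) / π =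
        1.5632 / π + N / (2 * Real.log 2) + 1.265 / (π * T) :=
      div_pi_identity 1.5632 N (Real.log 2) T π hπ.ne' hT0.ne' hlog2.ne'
    rw [e] at key1
    have : 1.265 / (π * T) ≤ 1.3 / (π * T) := div_le_div_of_nonneg_right (by norm_num) (by positivity)
    linarith
  exact key2.trans (final_numeric_hsw hℓ hℓL hLℓ hT)


end ZetaArgHSW

/-! ### All heights `T ≥ 30 610 046 000`, and Corollary 1.2 of Hasanalizade–Shen–Wong -/

/-- **`|S(T)| ≤ 0.1035 log T + 0.2395 log log T + 4.92` for every `T ≥ 30 610 046 000`.**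
At an ordinate one passes to non-ordinates `T'' ↓ T` with `N(T'') = N(T)` (right continuity of
`N`), using the continuity of `θ` and of the bound (as in
`Literature.NumberTheory.LFunctions.abs_zetaArgS_le_explicit`).  This is a version of
[HSW22, Theorem 1.3] (`0.1038 log T + 0.2573 log log T + 8.3675` there, with Platt's database below
`T₀` and Hiary's bound on the critical line) resting only on theorems of the tree.
[cite: HasanalizadeShenWong2022, Theorem 1.3] -/
theorem abs_zetaArgS_le_hsw {T : ℝ} (hT : 30610046000 ≤ T) :
    |zetaArgS T| ≤ 0.1035 * Real.log T + 0.2395 * Real.log (Real.log T) + 4.92 := by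
  have hT0 : 0 < T := by linarith
  have hπ := Real.pi_pos
  have hπ3 := Real.pi_gt_three
  have hlogT : 24 ≤ Real.log T := by
    rw [Real.le_log_iff_exp_le hT0]; exact ZetaArgHSW.assembly_numerics.1.trans hT
  refine le_of_forall_pos_le_add fun δ hδ ↦ ?_
  set C := 1 + Real.log (T + 1) / 2 with hC
  have hC0 : 0 < C := by
    have : 0 ≤ Real.log (T + 1) := Real.log_nonneg (by linarith)
    rw [hC]; linarith
  set K := 0.1035 / T + 0.2395 / (24 * T) + C / π + 1 with hK
  have hK0 : 0 < K := by rw [hK]; positivity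
  set ε := min (1 / 2) (δ / K) with hε
  have hε0 : 0 < ε := by rw [hε]; exact lt_min (by norm_num) (div_pos hδ hK0)
  have hε1 : ε ≤ 1 / 2 := min_le_left _ _
  have hεK : ε * K ≤ δ := by
    have : ε ≤ δ / K := min_le_right _ _
    rwa [le_div_iff₀ hK0] at this
  obtain ⟨T', h1, h2, h3⟩ := exists_gt_no_ordinate (T := T) hT0.le
  set T'' := min T' (T + ε) with hT''
  have hTT'' : T < T'' := lt_min h1 (by linarith)
  have hT''le : T'' ≤ T + ε := min_le_right _ _
  have hT''le' : T'' ≤ T' := min_le_left _ _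
  have h3'' : ∀ ρ : ℂ, riemannZeta ρ = 0 → ¬(T < ρ.im ∧ ρ.im ≤ T'') := fun ρ hρ ⟨ha, hb⟩ ↦
    h3 ρ hρ ⟨ha, hb.trans hT''le'⟩
  have hN : zetaZeroCount T'' = zetaZeroCount T := zetaZeroCount_eq_of_no_ordinate hTT''.le h3''
  have hT''ord : ∀ ρ : ℂ, riemannZeta ρ = 0 → ρ.im ≠ T'' := fun ρ hρ he ↦
    h3'' ρ hρ ⟨by rw [he]; exact hTT'', he.le⟩
  have hS'' := ZetaArgHSW.abs_zetaArgS_le_of_not_ordinate_hsw (by linarith : 30610046000 ≤ T'') hT''ord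
  have hθ := ZetaArgVariation.abs_riemannSiegelTheta_sub_le (by linarith : 7 ≤ T) hTT''.le (by linarith)
  have hdiff : zetaArgS T = zetaArgS T'' + (riemannSiegelTheta T'' - riemannSiegelTheta T) / π := by
    simp only [zetaArgS, hN]
    field_simp
    ring
  have hT''0 : 0 < T'' := by linarith
  -- `log T'' ≤ log T + ε/T` and `log log T'' ≤ log log T + ε/(24 T)`
  have hlog : Real.log T'' ≤ Real.log T + ε / T := by
    have h1 : Real.log T'' ≤ Real.log (T + ε) := Real.log_le_log hT''0 hT''le
    have h2 : Real.log (T + ε) - Real.log T ≤ ε / T := by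
      rw [← Real.log_div (by linarith) hT0.ne']
      have := Real.log_le_sub_one_of_pos (show 0 < (T + ε) / T by positivity)
      rw [show (T + ε) / T - 1 = ε / T by field_simp; ring] at this
      exact this
    linarith
  have hlog24 : 0 < Real.log T := by linarith
  have hloglog : Real.log (Real.log T'') ≤ Real.log (Real.log T) + ε / (24 * T) := by
    have hlogT'' : 0 < Real.log T'' := by
      have := Real.log_le_log hT0 hTT''.le; linarith
    have h1 : Real.log (Real.log T'') - Real.log (Real.log T) ≤ Real.log T'' / Real.log T - 1 := by
      rw [← Real.log_div hlogT''.ne' hlog24.ne']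
      exact Real.log_le_sub_one_of_pos (div_pos hlogT'' hlog24)
    have h2 : Real.log T'' / Real.log T - 1 ≤ (ε / T) / 24 := by
      rw [div_sub_one hlog24.ne', div_le_div_iff₀ hlog24 (by norm_num)]
      nlinarith [hlog, div_nonneg hε0.le hT0.le]
    have e : ε / T / 24 = ε / (24 * T) := by rw [div_div, mul_comm]
    linarith
  have hθ' : |(riemannSiegelTheta T'' - riemannSiegelTheta T) / π| ≤ C * ε / π := by
    rw [abs_div, abs_of_pos hπ]
    apply div_le_div_of_nonneg_right _ hπ.le
    refine hθ.trans ?_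
    rw [← hC]
    exact mul_le_mul_of_nonneg_left (by linarith) hC0.le
  rw [hdiff]
  have h4 := abs_add_le (zetaArgS T'') ((riemannSiegelTheta T'' - riemannSiegelTheta T) / π)
  have h5 : 0.1035 * Real.log T'' ≤ 0.1035 * Real.log T + 0.1035 / T * ε := by
    have := mul_le_mul_of_nonneg_left hlog (by norm_num : (0 : ℝ) ≤ 0.1035)
    linarith [show 0.1035 * (ε / T) = 0.1035 / T * ε by ring]
  have h5' : 0.2395 * Real.log (Real.log T'') ≤ 0.2395 * Real.log (Real.log T) + 0.2395 / (24 * T) * ε := by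
    have := mul_le_mul_of_nonneg_left hloglog (by norm_num : (0 : ℝ) ≤ 0.2395)
    linarith [show 0.2395 * (ε / (24 * T)) = 0.2395 / (24 * T) * ε by ring]
  have h6 : 0.1035 / T * ε + 0.2395 / (24 * T) * ε + C * ε / π ≤ ε * K := by
    have e : ε * (0.1035 / T + 0.2395 / (24 * T) + C / π + 1) =
        0.1035 / T * ε + 0.2395 / (24 * T) * ε + C * ε / π + ε := by ring
    rw [hK, e]
    linarith
  linarith

/-- **Theorem 1.3 of Hasanalizade–Shen–Wong at `T₀ = 30 610 046 000` (the hypothesis `h₁` of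
`Literature.NumberTheory.LFunctions.zetaZeroCount_hasanalizade_shen_wong_of_large`)**: for all
`T ≥ 30 610 046 000`, `|S(T)| ≤ 0.103787 log T + 0.257297 log log T + 8.367419` — indeed
`≤ 0.1035 log T + 0.2395 log log T + 4.92`. [cite: HasanalizadeShenWong2022, Theorem 1.3 (Table 2, row 1)] -/
theorem abs_zetaArgS_le_hsw_table2 (T : ℝ) (hT : 30610046000 ≤ T) :
    |zetaArgS T| ≤ 0.103787 * Real.log T + 0.257297 * Real.log (Real.log T) + 8.367419 := by
  have h := abs_zetaArgS_le_hsw hT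
  have hT0 : 0 < T := by linarith
  have hlogT : 24 ≤ Real.log T := by
    rw [Real.le_log_iff_exp_le hT0]; exact ZetaArgHSW.assembly_numerics.1.trans hT
  have hll : 0 ≤ Real.log (Real.log T) := Real.log_nonneg (by linarith)
  nlinarith

/-- **Corollary 1.2 of Hasanalizade–Shen–Wong** (the named fact
`Literature.NumberTheory.LFunctions.zetaZeroCount_hasanalizade_shen_wong`): for every `T ≥ e`,
`|N(T) − (T/2π) log(T/2πe)| ≤ 0.1038 log T + 0.2573 log log T + 9.3675`.  Discharged through
`Literature.NumberTheory.LFunctions.zetaZeroCount_hasanalizade_shen_wong_of_large`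
(`ZetaArgBacklundExplicit.lean`: the reduction of the corollary to a bound of the strength of
[HSW22, Thm 1.3] for `T ≥ 30 610 046 000`, with the tree's explicit Backlund bound and `N(30) ≤ 7`
below) and `abs_zetaArgS_le_hsw_table2` (Backlund's trick with Patel's sub-Weyl bound, this file).
[cite: HasanalizadeShenWong2022, Corollary 1.2] -/
theorem zetaZeroCount_hasanalizade_shen_wong_holds : zetaZeroCount_hasanalizade_shen_wong :=
  zetaZeroCount_hasanalizade_shen_wong_of_large abs_zetaArgS_le_hsw_table2

namespace ZetaArgHSW
end ZetaArgHSW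

end Literature.NumberTheory.LFunctions
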